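import Mathlib
import Literature.Combinatorics.Optimization.MaxThreeSatSdpLowerBound
import Literature.Combinatorics.Optimization.SeparatingFunctionalPsdRank
import Literature.Combinatorics.Optimization.PsdRankBasicProperties
import Literature.Barriers.PneNP.TSPExtensionComplexityKaibelWeltge
import HarnessLib

/-!
# Sum-of-squares certificates give psd factorisations, and the Grover polynomials: a de-quantised
# toolkit for psd-rank UPPER bounds (Kaniewski–Lee–de Wolf 2015, Theorems 12, 18, 20, 21), PROVED

J. Kaniewski, T. Lee, R. de Wolf, *Query complexity in expectation*, ICALP 2015, LNCS 9134, 761–772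
= arXiv:1411.7280 [KaniewskiLeeDewolf2015] (held text `paper:arxiv-1411.7280`; locators = pages of
that rendering).  The paper characterises the quantum query complexity of computing a nonnegative
function `f : {0,1}^n → ℝ_+` *in expectation* by its sum-of-squares degree (**Theorem 12**, p. 8:
"`QE(f) = deg_sos(f)`", with **Definition 7**, p. 5: "A sum-of-squares polynomial of degree `d` is a
polynomial `p` that can be written in the form `p(x) = Σ_{i∈𝒫} p_i(x)²` … the `p_i` are polynomials of
degree `≤ d`. The sos degree of `f` … is the minimum `d` for which such a `p` equals `f` on `{0,1}^n`")
and converts query algorithms into psd factorisations (**Theorem 18**, p. 12, verbatim): "Let `Y` be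
a finite set. For every `y ∈ Y`, let `f_y : {0,1}^n → ℝ_+` satisfy `QE(f_y) ≤ T`. Define a
`2^n × |Y|` matrix `M` by `M(x,y) = f_y(x)`. Then `QCE(M) ≤ 2T(log(n)+1)`, and hence
`psdrk(M) ≤ (2n)^{2T}`"; the authors note "Lee et al. [LRS] independently proved a similar upper
bound on psd rank, stated in terms of the sos degree of the `f_y` rather than quantum query
complexity (which are equal by Theorem 12)".  Its application (§7.3, Theorem 19: an exponentially
close approximation of the matching slack matrix of psd rank `2^{O(n^{1/2+ε}(log n)²)}`) rests on
the Appendix, **Theorem 20** (p. 14, verbatim): "For every integer `ℓ > 0` there exists a quantum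
algorithm that makes `O(√(mℓ) log m)` queries to input `z ∈ {0,1}^m` and that has the following
properties: If `z = 0^m` then the algorithm outputs “no solution” with certainty. If `|z| ∈ {1,…,ℓ}`
then the algorithm outputs a solution with certainty. If `|z| > ℓ` then the algorithm outputs a
solution with probability `≥ 1 − 2^{−√(ℓ|z|)}`" (proof: "Run exact Grover `ℓ` times, once for each of
the possibilities `t = 1,2,…,ℓ`. For `i = ⌊log ℓ⌋,…,⌊log m⌋`: Run `⌈√(ℓ2^{i+1})⌉` times the version of
Grover that assumes `|z| ∈ [2^i, 2^{i+1}]`"), and **Theorem 21** (p. 14, verbatim): "For every `ε > 0`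
there exists a function `f : {0,1}^m → ℝ_+` satisfying `QE(f) = O(m^{1/2+ε} log m)` and `f(0^m) = 0`.
If `|z| ∈ {1,…,ℓ}` then `f(z) = |z| − 1`. If `|z| > ℓ` then `|z| − 1 − 2^{−m^{2ε}} ≤ f(z) ≤ |z| − 1`"
(proof: "Set `ℓ = m^{2ε}` … If it did not find a solution the algorithm outputs 0. If, on the other
hand, `i` is a solution then the algorithm queries a uniformly random index `j ≠ i` and outputs
`z_j·(m−1)` … the expected value of the output is `(|z|−1)/(m−1)·(m−1) = |z| − 1`").

## What is here (everything PROVED; no named facts; no quantum computing)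

The tree's cube vocabulary is that of `PatternMatrixPsdRank.lean` / `SosPseudoDensityDuality.lean`
(`HasDegreeLE k g`: agrees on `{0,1}^N` with a polynomial of total degree `≤ k`;
`HasSosCertificate d f`: `f = Σ g_i²` on the cube with `deg g_i ≤ d/2`; `HasPsdFactorization M r`).

* **Theorem 18 / the polynomial method, sos form** (`hasPsdFactorization_of_hasSosCertificate`): if
  every column function `f_y` has a degree-`2D` sos certificate on `{0,1}^N` then `(f_y(x))_{x,y}` has
  a psd factorisation of size `#{S ⊆ [N] : |S| ≤ D} = Σ_{i≤D} C(N,i)` (`≤ 1 + N^D`, the tree's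
  `sum_range_choose_le_one_add_pow`): row factors are the Gram matrices `χ(x)χ(x)ᵀ` of the truncated
  Walsh vector `(χ_S(x))_{|S|≤D}`, column factors the Gram matrices of the Walsh coefficient vectors
  of the `g_i` (Fourier inversion `sum_cubeFourierCoeff_mul_walsh` + `HasDegreeLE.cubeFourierCoeff_eq_zero`);
  with the cone algebra `HasSosCertificate.mul/.sum/.list_prod`, `hasSosCertificate_prod`, and the
  SYMMETRIC GENERATORS of the cone in the weight `w = |x ∩ A|` on a coordinate set `A`, `|A| = m`:
  `w·q(w)² = Σ_{i∈A}(x_i q)²`, `(m − w)·q² = Σ_{i∈A}((1−x_i)q)²`, `w(w−1)·q² = Σ_{i≠j∈A}(x_i x_j q)²`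
  (`hasSosCertificate_wt_mul_sq`, `…_card_sub_wt_mul_sq`, `…_wt_mul_wt_sub_one_mul_sq`; a univariate
  polynomial in a degree-1 function has the polynomial's degree, `hasDegreeLE_polynomial_eval`).
* **The Grover polynomials** (`GroverPolynomial.a/.b`): the pair `(a_r, b_r) ∈ ℝ[X]²` with
  `cos((2r+1)θ) = cos θ·a_r(cos²θ)`, `sin((2r+1)θ) = sin θ·b_r(cos²θ)` (`cos_sin_odd_mul`, by the
  double-angle recurrence), unitarity `X a_r² + (1−X) b_r² = 1` (`X_mul_a_sq_add`), `deg ≤ r`.  A RUN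
  `(r, μ)` has failure value `fail = (1 − k/μ)a_r(1 − k/μ)² = cos²((2r+1)·arcsin√(k/μ))`
  (`fail_eq_cos_sq`) and success value `succ = 1 − fail = (k/μ)b_r²`; for `μ ≥ |A|` both `fail(|x∩A|)`
  and the PAID success `(|x∩A|−1)·succ(|x∩A|)` are cube sums of squares of degrees `r+1`, `r+2`
  (`hasSosCertificate_fail`, `hasSosCertificate_wt_sub_one_mul_succ`) — "exact Grover" is the
  rescaling `μ_r(t) = t/sin²(π/(2(2r+1)))`, for which `fail(t) = cos²(π/2) = 0` EXACTLY
  (`fail_exactMu_self`), admissible (`μ ≥ m`) as soon as `r ≥ r(m,t) = ⌈(π/4)√(m/t)⌉`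
  (`le_exactMu_iter`); "Grover that assumes `|z| ∈ [t, ρt]`" is the SAME run read on the window
  `t ≤ k ≤ 1.21t`, where `fail ≤ 15/16` (`fail_exactMu_le`, via Jordan's inequality `2θ/π ≤ sin θ`
  and `π < 3.15`).
* **The schedule and `F`** (`GroverSchedule`): exact runs `t = 1..ℓ`, then `4(L+1)+1` geometric
  scales `t_j = (ℓ+1)·1.21^j`, each repeated `R = 16(ℓ+L+3)` times; `F(k) = (k−1)(1 − Π_i fail_i(k))`
  `= Σ_i [(k−1)succ_i] Π_{j<i} fail_j` (`F_eq_sum`, telescoping `one_sub_prod_range`), hence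
  `x ↦ F(|x∩A|)` has an sos certificate of degree `2·halfDeg`, `halfDeg = 1 + Σ_i (r_i+1)`
  (`hasSosCertificate_F`); `F(k) = k−1` for integer `1 ≤ k ≤ ℓ` (`F_eq_of_le`); for
  `ℓ+1 ≤ k ≤ m < 2^{L+1}`: `k − 1 − 2^{−(ℓ+1)} ≤ F(k) ≤ k − 1` (`sub_le_F`, `F_le`; scale selection
  `exists_scale`, `prodFail_le : Π fail ≤ (15/16)^R`); and the query count
  `halfDeg ≤ 1 + 2√m√ℓ + 2ℓ + R(11√(m/(ℓ+1)) + 2·#scales)` (`halfDeg_le`; `Σ_{t≤ℓ} t^{−1/2} ≤ 2√ℓ`,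
  `Σ_j (10/11)^j ≤ 11`).

* **Lee–Raghavendra–Steurer 2015, Theorem 1.8, upper bound** (arXiv:1411.6317, statement p. 7:
  "`1 + n^{1+d/2} ≥ rk_psd(M_n^f)`" for `d + 2 = deg_sos(f)`; proof p. 17: "`Tr(P_S Q_x) = Σ_j (Σ_{A∈𝓕}
  x^A ĝ_{S,j}(A))² = Σ_j g_{S,j}(x)² = f(x_S) = M_n^f(S,x)` … an explicit psd factorization … of
  dimension `r = Σ_{i ≤ 1+d/2} C(n,i) ≤ 1 + n^{1+d/2}`") in the tree's pattern-matrix currency: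
  `hasPsdFactorization_patternMatrix_of_hasSosCertificate` (`HasSosCertificate (2D) f ⇒
  HasPsdFactorization (patternMatrix n f) (Σ_{i≤D} C(n,i))`) and `…_one_add_pow` (size `1 + n^D`),
  via `HasSosCertificate.comp_cubeRestrict` (restriction `x ↦ x_S` preserves degree) — section
  `PatternMatrixUpperBound` at the end of the file.

* **§7.2, "the `log n` factor in Theorem 18 is necessary"** (p. 12, verbatim: "Consider the function
  `f(x) = (|x|−1)²`. Then `QE(f) = 1` by Theorem 12. On the other hand `psdrk(M_f) ≥ n/√2`: it is easy
  to see that the rank of `M` is at most the square of its psd rank, and the rank of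
  `M_f(x,y) = (|x ∧ y|−1)²` is `n²/2 + 1` using [BW01]"): section `LogFactorNecessary` proves the EXACT
  value `rk_psd(M_f) = n + 1` — upper bound by Theorem 18 with `D = 1` (`hasPsdFactorization_klwMatrix`),
  lower bound `n + 1 ≤ k` for every size-`k` factorisation (`le_of_hasPsdFactorization_klwMatrix`: the
  `{1_T : |T| ≤ 2}`-submatrix is `ZᵀDZ` with `Z` the unitriangular zeta matrix, so `rank M_f ≥ 1 + n +
  C(n,2) = C(n+1,2) + 1`, while `rank ≤ C(k+1,2)` by the tree's FGPRT Prop. 2.5), whence the printed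
  `n/√2 ≤ k` (`KaniewskiLeeDewolf2015_logFactor`).

* **Fiorini–Massar–Pokutta–Tiwary–de Wolf, J. ACM 62 (2015) = arXiv:1111.0837, Corollary 22 — the
  exponential separation of nonnegative and psd rank** (p. 15 of the held text, verbatim: "For each
  `n`, there exists `M ∈ ℝ_+^{2^n×2^n}`, with `nnegrk(M) = 2^{Ω(n)}` and `psdrk(M) = O(n)`. In fact a
  simple rank-`(n+1)` PSD factorization of `M` is the following: let `T_a := (1;−a)(1;−a)ᵀ` and
  `U^b := (1;b)(1;b)ᵀ`, then `Tr[(T_a)ᵀU^b] = (1 − aᵀb)² = M_ab`"): the SAME matrix `klwMatrix`,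
  `nnegrk ≥ (3/2)^n` by the tree's Kaibel–Weltge covering count (`FioriniEtAl2015_cor22_nonneg`:
  `HasNonnegFactorization (klwMatrix n) r → 3^n ≤ r·2^n`) next to `psdrk = n + 1`
  (`FioriniEtAl2015_cor22`).

Recorded deviations from the printed (quantum) proofs: (1) no quantum algorithms — every
"probability" is an explicit polynomial in the weight, every "run" a pair of Chebyshev-type
polynomials, and the sos structure that Theorem 12 extracts from amplitudes is written down directly
from the generators above; (2) exact Grover is realised by the continuous rescaling `μ_r(t)` (the
ancilla rotation), not by a modified last iteration; (3) scales have ratio `1.21` (not `2`) and the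
window guarantee is `fail ≤ 15/16` (not `1/2`); (4) each scale is repeated `R = 16(ℓ+L+3)` times
independently of the scale (the needed exponent is `ℓ + log m`, not the printed `√(ℓ|z|)`; the
printed third bullet of Theorem 21 drops a factor `|z| − 1`, which these constants absorb).  Constants
are explicit and not optimised.  The application to the matching slack matrix (Theorem 19) is
`Literature/Barriers/PneNP/MatchingSlackPsdApproximationProof.lean`.
-/

noncomputable section

open Finset Matrix
open scoped MatrixOrder BigOperators

namespace Literature.Combinatorics.Optimization

open Literature.Probability.RandomGraphs.LowDegree (walsh)
open Literature.Computability.Complexity.LowDegree (cubeFourierCoeff sum_cubeFourierCoeff_mul_walsh)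

variable {N : ℕ}

/-! ### Products and sums of sos certificates -/

/-- `Σ_{d₁} · Σ_{d₂} ⊆ Σ_{d₁+d₂}`: products of sums of squares are sums of squares, degrees add
(`(Σ aᵢ²)(Σ bⱼ²) = Σ (aᵢbⱼ)²`). [cite: KaniewskiLeeDewolf2015, Thm. 18 proof (p. 12)] -/
theorem HasSosCertificate.mul {d₁ d₂ : ℕ} {f g : (Fin N → Bool) → ℝ} (hf : HasSosCertificate d₁ f)
    (hg : HasSosCertificate d₂ g) : HasSosCertificate (d₁ + d₂) (fun x => f x * g x) := by
  obtain ⟨k, u, hu, hfx⟩ := hf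
  obtain ⟨k', u', hu', hgx⟩ := hg
  refine hasSosCertificate_of_fintype (ι := Fin k × Fin k') (fun p x => u p.1 x * u' p.2 x)
    (fun p => ((hu p.1).mul (hu' p.2)).mono ?_) fun x => ?_
  · omega
  · rw [hfx x, hgx x, Fintype.sum_prod_type, Finset.sum_mul_sum]
    refine sum_congr rfl fun i _ => sum_congr rfl fun j _ => ?_
    ring

/-- Finite sums stay in `Σ_d`. [cite: LeeRaghavendraSteurer2015, §2 (p. 11: "convex cone")] -/
theorem HasSosCertificate.sum {d : ℕ} {ι : Type*} (s : Finset ι) {f : ι → (Fin N → Bool) → ℝ}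
    (hf : ∀ i ∈ s, HasSosCertificate d (f i)) : HasSosCertificate d (fun x => ∑ i ∈ s, f i x) := by
  classical
  induction s using Finset.induction_on with
  | empty => simpa using HasSosCertificate.zero (m := N) d
  | insert a s ha ih =>
    have h := (hf a (Finset.mem_insert_self _ _)).add
      (ih fun i hi => hf i (Finset.mem_insert_of_mem hi))
    simpa [Finset.sum_insert ha] using h

/-- Products over a list: degrees add up. [cite: KaniewskiLeeDewolf2015, Thm. 18 proof (p. 12)] -/
theorem HasSosCertificate.list_prod {ι : Type*} (l : List ι) {d : ι → ℕ}
    {f : ι → (Fin N → Bool) → ℝ} (hf : ∀ i ∈ l, HasSosCertificate (d i) (f i)) :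
    HasSosCertificate (l.map d).sum (fun x => (l.map fun i => f i x).prod) := by
  induction l with
  | nil => simpa using HasSosCertificate.one (m := N) 0
  | cons a l ih =>
    have h := (hf a (by simp)).mul (ih fun i hi => hf i (by simp [hi]))
    simpa using h

/-! ### Coordinates, weights, univariate polynomials in the weight -/

/-- The coordinate function `x ↦ x_i ∈ {0,1}`. [cite: LeeRaghavendraSteurer2015, §2 (functions on the discrete cube)] -/
def coordFn (i : Fin N) (x : Fin N → Bool) : ℝ := if x i then 1 else 0

/-- `coordFn` is the coordinate of `cubePoint`. [cite: LeeRaghavendraSteurer2015, §2 (functions on the discrete cube)] -/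
theorem coordFn_eq_cubePoint (i : Fin N) (x : Fin N → Bool) : coordFn i x = cubePoint x i := rfl

/-- `x_i² = x_i` on the cube. [folklore] -/
private theorem coordFn_sq (i : Fin N) (x : Fin N → Bool) : coordFn i x ^ 2 = coordFn i x := by
  unfold coordFn; split_ifs <;> norm_num

/-- `x_i·x_i = x_i` on the cube. [folklore] -/
private theorem coordFn_mul_self (i : Fin N) (x : Fin N → Bool) : coordFn i x * coordFn i x = coordFn i x := by
  rw [← sq, coordFn_sq]

/-- `(1 − x_i)² = 1 − x_i` on the cube. [folklore] -/
private theorem one_sub_coordFn_sq (i : Fin N) (x : Fin N → Bool) : (1 - coordFn i x) ^ 2 = 1 - coordFn i x := by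
  unfold coordFn; split_ifs <;> norm_num

/-- `0 ≤ x_i`. [folklore] -/
private theorem coordFn_nonneg (i : Fin N) (x : Fin N → Bool) : 0 ≤ coordFn i x := by
  unfold coordFn; split_ifs <;> norm_num

/-- `x_i ≤ 1`. [folklore] -/
private theorem coordFn_le_one (i : Fin N) (x : Fin N → Bool) : coordFn i x ≤ 1 := by
  unfold coordFn; split_ifs <;> norm_num

/-- Coordinates have degree `≤ 1` (the polynomial `X_i`). [cite: LeeRaghavendraSteurer2015, §2] -/
theorem hasDegreeLE_coordFn (i : Fin N) : HasDegreeLE 1 (coordFn i) :=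
  ⟨MvPolynomial.X i, by rw [MvPolynomial.totalDegree_X], fun x => by
    rw [MvPolynomial.eval_X]; rfl⟩

/-- The weight of `x` on the coordinate set `A`: `|x ∩ A| = Σ_{i ∈ A} x_i`. [cite: KaniewskiLeeDewolf2015, §7.3 (p. 12: "x_M denotes the restriction of x to the m positions in the support of M")] -/
def wt (A : Finset (Fin N)) (x : Fin N → Bool) : ℝ := ∑ i ∈ A, coordFn i x

/-- The weight `|x ∩ A|` has degree `≤ 1`. [folklore] -/
private theorem hasDegreeLE_wt (A : Finset (Fin N)) : HasDegreeLE 1 (wt A) :=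
  HasDegreeLE.sum A fun i _ => hasDegreeLE_coordFn i

/-- The weight is the number of coordinates of `A` that are set. [cite: KaniewskiLeeDewolf2015, §7.3 (p. 12: "|δ(U) ∩ M|", the weight of the restriction x_M)] -/
theorem wt_eq_card_filter (A : Finset (Fin N)) (x : Fin N → Bool) :
    wt A x = ((A.filter fun i => x i).card : ℝ) := by
  unfold wt coordFn
  rw [Finset.card_filter, Nat.cast_sum]
  simp

/-- `0 ≤ |x ∩ A|`. [folklore] -/
private theorem wt_nonneg (A : Finset (Fin N)) (x : Fin N → Bool) : 0 ≤ wt A x :=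
  sum_nonneg fun i _ => coordFn_nonneg i x

/-- `|x ∩ A| ≤ |A|`. [folklore] -/
private theorem wt_le_card (A : Finset (Fin N)) (x : Fin N → Bool) : wt A x ≤ A.card := by
  unfold wt
  calc ∑ i ∈ A, coordFn i x ≤ ∑ i ∈ A, (1 : ℝ) := sum_le_sum fun i _ => coordFn_le_one i x
    _ = A.card := by simp

/-- `Σ_{i∈A} (1 − x_i) = |A| − |x ∩ A|`. [folklore] -/
private theorem sum_one_sub_coordFn (A : Finset (Fin N)) (x : Fin N → Bool) :
    ∑ i ∈ A, (1 - coordFn i x) = A.card - wt A x := by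
  rw [sum_sub_distrib]; simp [wt]

/-- `Σ_{i ≠ j ∈ A} x_i x_j = |x∩A|(|x∩A| − 1)`. [folklore] -/
private theorem sum_offDiag_coordFn_mul (A : Finset (Fin N)) (x : Fin N → Bool) :
    ∑ p ∈ A.offDiag, coordFn p.1 x * coordFn p.2 x = wt A x * (wt A x - 1) := by
  classical
  have h := Finset.sum_product (s := A) (t := A) (f := fun p : Fin N × Fin N => coordFn p.1 x * coordFn p.2 x)
  have hsplit : A ×ˢ A = A.offDiag ∪ A.diag := (Finset.diag_union_offDiag A).symm.trans (union_comm _ _)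
  have hdisj : Disjoint A.offDiag A.diag := (Finset.disjoint_diag_offDiag A).symm
  rw [hsplit, sum_union hdisj] at h
  have hdiag : ∑ p ∈ A.diag, coordFn p.1 x * coordFn p.2 x = wt A x := by
    rw [Finset.diag, sum_map]
    simp only [Function.Embedding.coeFn_mk, coordFn_mul_self]
    rfl
  have hprod : ∑ i ∈ A, ∑ j ∈ A, coordFn i x * coordFn j x = wt A x * wt A x := by
    rw [← sum_mul_sum]; rfl
  rw [hdiag, hprod] at h
  linarith

/-- A univariate polynomial in a degree-`≤ 1` function has degree at most the degree of the
polynomial. [cite: KaniewskiLeeDewolf2015, Lemma 11 / Thm. 12 (p. 8: amplitudes are multilinear polynomials of degree ≤ t; QE(f) = deg_sos(f))] -/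
theorem hasDegreeLE_polynomial_eval {L : (Fin N → Bool) → ℝ} (hL : HasDegreeLE 1 L)
    (p : Polynomial ℝ) {d : ℕ} (hp : p.natDegree ≤ d) :
    HasDegreeLE d (fun x => p.eval (L x)) := by
  have hpow : ∀ j : ℕ, HasDegreeLE j (fun x => L x ^ j) := by
    intro j
    induction j with
    | zero => simpa using HasDegreeLE.const (m := N) 0 1
    | succ j ih => simpa [pow_succ] using ih.mul hL
  have h : HasDegreeLE d (fun x => ∑ j ∈ Finset.range (d + 1), p.coeff j * L x ^ j) :=
    HasDegreeLE.sum _ fun j hj => ((hpow j).const_mul (p.coeff j)).mono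
      (Nat.lt_succ_iff.mp (Finset.mem_range.mp hj))
  convert h using 2 with x
  rw [Polynomial.eval_eq_sum_range' (Nat.lt_succ_of_le hp)]

/-! ### The weight generators of the symmetric sos cone -/

/-- `|x∩A| · q(x)² = Σ_{i∈A} (x_i q(x))²` is a degree-`2(h+1)` sum of squares when `deg q ≤ h`.
[cite: KaniewskiLeeDewolf2015, App. Thm. 21 proof (p. 14)] -/
theorem hasSosCertificate_wt_mul_sq (A : Finset (Fin N)) {h : ℕ} {q : (Fin N → Bool) → ℝ}
    (hq : HasDegreeLE h q) : HasSosCertificate (2 * (h + 1)) (fun x => wt A x * q x ^ 2) := by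
  have : (fun x => wt A x * q x ^ 2) = fun x => ∑ i ∈ A, (coordFn i x * q x) ^ 2 := by
    funext x
    rw [wt, sum_mul]
    refine sum_congr rfl fun i _ => ?_
    rw [mul_pow, coordFn_sq]
  rw [this]
  refine HasSosCertificate.sum A fun i _ => HasDegreeLE.hasSosCertificate_sq ?_
  have e : 2 * (h + 1) / 2 = 1 + h := by omega
  rw [e]
  exact (hasDegreeLE_coordFn i).mul hq

/-- `(|A| − |x∩A|) · q(x)² = Σ_{i∈A} ((1 − x_i) q(x))²`. [cite: KaniewskiLeeDewolf2015, App. Thm. 21 proof (p. 14)] -/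
theorem hasSosCertificate_card_sub_wt_mul_sq (A : Finset (Fin N)) {h : ℕ} {q : (Fin N → Bool) → ℝ}
    (hq : HasDegreeLE h q) :
    HasSosCertificate (2 * (h + 1)) (fun x => (A.card - wt A x) * q x ^ 2) := by
  have : (fun x => (A.card - wt A x) * q x ^ 2) = fun x => ∑ i ∈ A, ((1 - coordFn i x) * q x) ^ 2 := by
    funext x
    rw [← sum_one_sub_coordFn, sum_mul]
    refine sum_congr rfl fun i _ => ?_
    rw [mul_pow, one_sub_coordFn_sq]
  rw [this]
  refine HasSosCertificate.sum A fun i _ => HasDegreeLE.hasSosCertificate_sq ?_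
  have e : 2 * (h + 1) / 2 = 1 + h := by omega
  rw [e]
  exact ((HasDegreeLE.const (m := N) 1 1).sub (hasDegreeLE_coordFn i)).mul hq

/-- `|x∩A|(|x∩A| − 1) · q(x)² = Σ_{i≠j∈A} (x_i x_j q(x))²`. [cite: KaniewskiLeeDewolf2015, App. Thm. 21 proof (p. 14: "queries a uniformly random index j ≠ i and outputs z_j·(m−1)")] -/
theorem hasSosCertificate_wt_mul_wt_sub_one_mul_sq (A : Finset (Fin N)) {h : ℕ}
    {q : (Fin N → Bool) → ℝ} (hq : HasDegreeLE h q) :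
    HasSosCertificate (2 * (h + 2)) (fun x => wt A x * (wt A x - 1) * q x ^ 2) := by
  classical
  have : (fun x => wt A x * (wt A x - 1) * q x ^ 2) =
      fun x => ∑ p ∈ A.offDiag, (coordFn p.1 x * coordFn p.2 x * q x) ^ 2 := by
    funext x
    rw [← sum_offDiag_coordFn_mul, sum_mul]
    refine sum_congr rfl fun p _ => ?_
    rw [mul_pow, mul_pow, coordFn_sq, coordFn_sq]
  rw [this]
  refine HasSosCertificate.sum _ fun p _ => HasDegreeLE.hasSosCertificate_sq ?_
  have e : 2 * (h + 2) / 2 = 1 + 1 + h := by omega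
  rw [e]
  exact ((hasDegreeLE_coordFn p.1).mul (hasDegreeLE_coordFn p.2)).mul hq

/-- Nonnegative constants times squares. [cite: LeeRaghavendraSteurer2015, §2 (p. 11)] -/
theorem hasSosCertificate_const_mul_sq {c : ℝ} (hc : 0 ≤ c) {h : ℕ} {q : (Fin N → Bool) → ℝ}
    (hq : HasDegreeLE h q) : HasSosCertificate (2 * h) (fun x => c * q x ^ 2) := by
  refine (HasDegreeLE.hasSosCertificate_sq ?_).const_mul hc
  have e : 2 * h / 2 = h := by omega
  rwa [e]

/-! ### From sos certificates to psd factorisations -/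

/-- A matrix whose entries are sums of squares of bilinear pairings against a COMMON row vector,
`M(i,j) = Σ_s ⟨b_i, a_{j,s}⟩²`, has a psd factorisation of the size of the vectors
(`A_i = b_i b_iᵀ`, `B_j = Σ_s a_{j,s} a_{j,s}ᵀ`). [cite: KaniewskiLeeDewolf2015, Thm. 17 proof (p. 11: "A_x(i,j) = ⟨a_i(x)|a_j(x)⟩")] -/
theorem hasPsdFactorization_of_sum_sq_dotProduct {ι κ τ : Type*} [Fintype τ]
    {M : ι → κ → ℝ} (b : ι → τ → ℝ) (k : κ → ℕ) (a : (j : κ) → Fin (k j) → τ → ℝ)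
    (hM : ∀ i j, M i j = ∑ s : Fin (k j), (∑ t, b i t * a j s t) ^ 2) :
    HasPsdFactorization M (Fintype.card τ) := by
  classical
  let e : τ ≃ Fin (Fintype.card τ) := Fintype.equivFin τ
  let b' : ι → Fin (Fintype.card τ) → ℝ := fun i l => b i (e.symm l)
  let a' : (j : κ) → Fin (k j) → Fin (Fintype.card τ) → ℝ := fun j s l => a j s (e.symm l)
  refine ⟨fun i => vecMulVec (b' i) (b' i), fun j => ∑ s, vecMulVec (a' j s) (a' j s),
    fun i => by simpa using posSemidef_vecMulVec_self_star (b' i),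
    fun j => posSemidef_sum _ fun s _ => by simpa using posSemidef_vecMulVec_self_star (a' j s),
    fun i j => ?_⟩
  rw [hM i j, Finset.mul_sum, trace_sum]
  refine sum_congr rfl fun s _ => ?_
  have h1 : b' i ⬝ᵥ a' j s = ∑ t, b i t * a j s t := by
    simp only [dotProduct, b', a']
    exact e.symm.sum_comp (fun t => b i t * a j s t)
  rw [vecMulVec_mul_vecMulVec, trace_vecMulVec, dotProduct_smul, smul_eq_mul, h1, sq]

/-- The index set of multilinear monomials of degree `≤ D` in `N` variables. [cite: KaniewskiLeeDewolf2015, Thm. 18 (p. 12: "psdrk(M) ≤ (2n)^{2T}")] -/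
abbrev LowSets (N D : ℕ) : Type := {S : Finset (Fin N) // S.card ≤ D}

/-- `#{S ⊆ [N] : |S| ≤ D} = Σ_{i ≤ D} C(N, i)`. [cite: LeeRaghavendraSteurer2015, Thm 6.4 proof (p. 26)] -/
theorem card_lowSets (N D : ℕ) :
    Fintype.card (LowSets N D) = ∑ i ∈ Finset.range (D + 1), N.choose i := by
  rw [Fintype.card_subtype, card_filter_card_le]

/-- A degree-`≤ D` function on the cube is its Walsh expansion truncated at level `D`.
[cite: LeeRaghavendraSteurer2015, Fact 6.3 (p. 25)] -/
theorem HasDegreeLE.eq_sum_lowSets {D : ℕ} {g : (Fin N → Bool) → ℝ} (hg : HasDegreeLE D g)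
    (x : Fin N → Bool) : g x = ∑ S : LowSets N D, cubeFourierCoeff g S.1 * walsh S.1 x := by
  classical
  calc g x = ∑ S, cubeFourierCoeff g S * walsh S x := (sum_cubeFourierCoeff_mul_walsh g x).symm
    _ = ∑ S ∈ univ.filter (fun S : Finset (Fin N) => S.card ≤ D),
          cubeFourierCoeff g S * walsh S x := by
        rw [Finset.sum_filter]
        refine sum_congr rfl fun S _ => ?_
        split_ifs with h
        · rfl
        · rw [hg.cubeFourierCoeff_eq_zero (lt_of_not_ge h), zero_mul]
    _ = ∑ S : LowSets N D, cubeFourierCoeff g S.1 * walsh S.1 x :=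
        Finset.sum_subtype _ (fun S => by simp) (fun S => cubeFourierCoeff g S * walsh S x)

/-- **Kaniewski–Lee–de Wolf, Theorem 18 (polynomial form; also Lee–Raghavendra–Steurer):** if every
column function `f_y : {0,1}^N → ℝ_{≥0}` is a sum of squares of functions of degree `≤ D` on the
cube, then the matrix `(f_y(x))_{x,y}` has a psd factorisation of size `#{S ⊆ [N] : |S| ≤ D} =
Σ_{i ≤ D} C(N,i)` (row factors: the Gram matrix of the truncated character vector `(χ_S(x))_{|S|≤D}`;
column factors: the Gram matrices of the Walsh coefficient vectors of the squares' roots).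
[cite: KaniewskiLeeDewolf2015, Thm. 18 (p. 12)] -/
theorem hasPsdFactorization_of_hasSosCertificate {κ : Type*} {D : ℕ}
    (f : κ → (Fin N → Bool) → ℝ) (hf : ∀ y, HasSosCertificate (2 * D) (f y)) :
    HasPsdFactorization (fun (x : Fin N → Bool) (y : κ) => f y x)
      (∑ i ∈ Finset.range (D + 1), N.choose i) := by
  classical
  choose k g hg hfx using hf
  have hD : 2 * D / 2 = D := by omega
  rw [← card_lowSets N D]
  refine hasPsdFactorization_of_sum_sq_dotProduct (fun x (S : LowSets N D) => walsh S.1 x) k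
    (fun y s S => cubeFourierCoeff (g y s) S.1) fun x y => ?_
  rw [hfx y x]
  refine sum_congr rfl fun s _ => ?_
  have hgs : HasDegreeLE D (g y s) := hD ▸ hg y s
  rw [hgs.eq_sum_lowSets x]
  congr 1
  exact sum_congr rfl fun S _ => mul_comm _ _

open Polynomial Real

namespace GroverPolynomial

/-! ### The pair `(a_r, b_r)`: `cos((2r+1)θ) = cos θ · a_r(cos²θ)`, `sin((2r+1)θ) = sin θ · b_r(cos²θ)` -/

/-- The pair `(a_r, b_r) ∈ ℝ[X]²`, by the double-angle recurrence
`a_{r+1} = (2X−1)a_r − 2(1−X)b_r`, `b_{r+1} = (2X−1)b_r + 2X a_r`, `a_0 = b_0 = 1`.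
[cite: KaniewskiLeeDewolf2015, App. Thm. 20 (p. 14: "versions of Grover")] -/
def pair : ℕ → ℝ[X] × ℝ[X]
  | 0 => (1, 1)
  | r + 1 => ((2 * X - 1) * (pair r).1 - 2 * (1 - X) * (pair r).2,
      (2 * X - 1) * (pair r).2 + 2 * X * (pair r).1)

/-- `a_r`: `cos((2r+1)θ)/cos θ` as a polynomial in `cos²θ`. [cite: KaniewskiLeeDewolf2015, App. Thm. 20 (p. 14)] -/
def a (r : ℕ) : ℝ[X] := (pair r).1

/-- `b_r`: `sin((2r+1)θ)/sin θ` as a polynomial in `cos²θ`. [cite: KaniewskiLeeDewolf2015, App. Thm. 20 (p. 14)] -/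
def b (r : ℕ) : ℝ[X] := (pair r).2

/-- `a_0 = 1`. [cite: KaniewskiLeeDewolf2015, App. Thm. 20 (p. 14)] -/
@[simp] theorem a_zero : a 0 = 1 := rfl
/-- `b_0 = 1`. [cite: KaniewskiLeeDewolf2015, App. Thm. 20 (p. 14)] -/
@[simp] theorem b_zero : b 0 = 1 := rfl
/-- The recurrence for `a_{r+1}`. [cite: KaniewskiLeeDewolf2015, App. Thm. 20 (p. 14)] -/
theorem a_succ (r : ℕ) : a (r + 1) = (2 * X - 1) * a r - 2 * (1 - X) * b r := rfl
/-- The recurrence for `b_{r+1}`. [cite: KaniewskiLeeDewolf2015, App. Thm. 20 (p. 14)] -/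
theorem b_succ (r : ℕ) : b (r + 1) = (2 * X - 1) * b r + 2 * X * a r := rfl

/-- **Pythagoras / unitarity:** `X·a_r² + (1−X)·b_r² = 1`. [cite: KaniewskiLeeDewolf2015, Thm. 17 proof (p. 11: probabilities of a quantum algorithm sum to one)] -/
theorem X_mul_a_sq_add (r : ℕ) : X * a r ^ 2 + (1 - X) * b r ^ 2 = 1 := by
  induction r with
  | zero => simp
  | succ r ih =>
    rw [a_succ, b_succ]
    linear_combination ((2 * X - 1) ^ 2 + 4 * X * (1 - X)) * ih

/-- Evaluated unitarity: `u·a_r(u)² + (1−u)·b_r(u)² = 1`. [cite: KaniewskiLeeDewolf2015, Thm. 17 proof (p. 11)] -/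
theorem eval_a_sq_add (r : ℕ) (u : ℝ) : u * (a r).eval u ^ 2 + (1 - u) * (b r).eval u ^ 2 = 1 := by
  have h := congrArg (Polynomial.eval u) (X_mul_a_sq_add r)
  simpa using h

/-- **The multiple-angle formulas:** `cos((2r+1)θ) = cos θ · a_r(cos²θ)` and
`sin((2r+1)θ) = sin θ · b_r(cos²θ)` (`r` Grover iterations rotate by `2θ` each).
[cite: KaniewskiLeeDewolf2015, App. Thm. 20 (p. 14)] -/
theorem cos_sin_odd_mul (r : ℕ) (θ : ℝ) :
    cos ((2 * r + 1) * θ) = cos θ * (a r).eval (cos θ ^ 2) ∧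
      sin ((2 * r + 1) * θ) = sin θ * (b r).eval (cos θ ^ 2) := by
  induction r with
  | zero => simp
  | succ r ih =>
    obtain ⟨hc, hs⟩ := ih
    have hang : (2 * ((r + 1 : ℕ) : ℝ) + 1) * θ = (2 * r + 1) * θ + 2 * θ := by push_cast; ring
    have hs2 : sin θ ^ 2 = 1 - cos θ ^ 2 := by rw [sin_sq]
    refine ⟨?_, ?_⟩
    · rw [hang, cos_add, hc, hs, a_succ, cos_two_mul, sin_two_mul]
      simp only [eval_sub, eval_mul, eval_ofNat, eval_X, eval_one]
      have : sin θ * eval (cos θ ^ 2) (b r) * (2 * sin θ * cos θ) =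
          cos θ * (2 * sin θ ^ 2 * eval (cos θ ^ 2) (b r)) := by ring
      rw [this, hs2]; ring
    · rw [hang, sin_add, hc, hs, b_succ, cos_two_mul, sin_two_mul]
      simp only [eval_add, eval_mul, eval_ofNat, eval_X, eval_one, eval_sub]
      ring

/-- `cos((2r+1)θ) = cos θ · a_r(cos²θ)`. [cite: KaniewskiLeeDewolf2015, App. Thm. 20 (p. 14)] -/
theorem cos_odd_mul (r : ℕ) (θ : ℝ) : cos ((2 * r + 1) * θ) = cos θ * (a r).eval (cos θ ^ 2) :=
  (cos_sin_odd_mul r θ).1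

/-- `sin((2r+1)θ) = sin θ · b_r(cos²θ)`. [cite: KaniewskiLeeDewolf2015, App. Thm. 20 (p. 14)] -/
theorem sin_odd_mul (r : ℕ) (θ : ℝ) : sin ((2 * r + 1) * θ) = sin θ * (b r).eval (cos θ ^ 2) :=
  (cos_sin_odd_mul r θ).2

/-! ### A run: failure and success values -/

/-- Failure value of the run `(r, μ)` at weight `k`: `(1 − k/μ)·a_r(1 − k/μ)²` (`= cos²((2r+1)θ)`,
`sin²θ = k/μ`). [cite: KaniewskiLeeDewolf2015, App. Thm. 20 (p. 14)] -/
def fail (r : ℕ) (μ k : ℝ) : ℝ := (1 - k / μ) * (a r).eval (1 - k / μ) ^ 2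

/-- Success value of the run `(r, μ)` at weight `k`: `(k/μ)·b_r(1 − k/μ)²` (`= sin²((2r+1)θ)`).
[cite: KaniewskiLeeDewolf2015, App. Thm. 20 (p. 14)] -/
def succ (r : ℕ) (μ k : ℝ) : ℝ := k / μ * (b r).eval (1 - k / μ) ^ 2

/-- Unitarity of a run: `fail + succ = 1`. [cite: KaniewskiLeeDewolf2015, Thm. 17 proof (p. 11)] -/
theorem fail_add_succ (r : ℕ) (μ k : ℝ) : fail r μ k + succ r μ k = 1 := by
  have h := eval_a_sq_add r (1 - k / μ)
  unfold fail succ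
  linear_combination h

/-- `fail ≥ 0` for `k ≤ μ`. [cite: KaniewskiLeeDewolf2015, App. Thm. 20 (p. 14)] -/
theorem fail_nonneg (r : ℕ) {μ k : ℝ} (hμ : 0 < μ) (hk : k ≤ μ) : 0 ≤ fail r μ k := by
  unfold fail
  refine mul_nonneg ?_ (sq_nonneg _)
  rw [sub_nonneg, div_le_one hμ]; exact hk

/-- `succ ≥ 0` for `k ≥ 0`. [cite: KaniewskiLeeDewolf2015, App. Thm. 20 (p. 14)] -/
theorem succ_nonneg (r : ℕ) {μ k : ℝ} (hμ : 0 < μ) (hk : 0 ≤ k) : 0 ≤ succ r μ k := by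
  unfold succ
  exact mul_nonneg (div_nonneg hk hμ.le) (sq_nonneg _)

/-- `fail ≤ 1` for `k ≥ 0`. [cite: KaniewskiLeeDewolf2015, App. Thm. 20 (p. 14)] -/
theorem fail_le_one (r : ℕ) {μ k : ℝ} (hμ : 0 < μ) (hk : 0 ≤ k) : fail r μ k ≤ 1 := by
  linarith [fail_add_succ r μ k, succ_nonneg r hμ hk]

/-- Trigonometric form: `fail_r(μ, k) = cos²((2r+1)·arcsin √(k/μ))` for `0 ≤ k ≤ μ`.
[cite: KaniewskiLeeDewolf2015, App. Thm. 20 (p. 14)] -/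
theorem fail_eq_cos_sq (r : ℕ) {μ k : ℝ} (hμ : 0 < μ) (hk0 : 0 ≤ k) (hk : k ≤ μ) :
    fail r μ k = cos ((2 * r + 1) * arcsin (sqrt (k / μ))) ^ 2 := by
  set θ := arcsin (sqrt (k / μ)) with hθ
  have hu0 : 0 ≤ sqrt (k / μ) := sqrt_nonneg _
  have hu1 : sqrt (k / μ) ≤ 1 := by
    rw [sqrt_le_one]; exact (div_le_one hμ).2 hk
  have hsin : sin θ = sqrt (k / μ) := sin_arcsin (by linarith) hu1
  have hcos2 : cos θ ^ 2 = 1 - k / μ := by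
    rw [cos_sq', hsin, sq_sqrt (div_nonneg hk0 hμ.le)]
  rw [cos_odd_mul, mul_pow, hcos2]
  rfl

/-! ### Exact runs: `μ_r(t) = t / sin²(π/(2(2r+1)))` makes `fail` vanish at `k = t` -/

/-- The angle `φ_r = π/(2(2r+1))` with `(2r+1)φ_r = π/2`. [cite: KaniewskiLeeDewolf2015, App. Thm. 20 (p. 14: "exact Grover")] -/
def phi (r : ℕ) : ℝ := π / (2 * (2 * r + 1))

/-- `φ_r > 0`. [folklore] -/
private theorem phi_pos (r : ℕ) : 0 < phi r := by unfold phi; positivity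

/-- `φ_r ≤ π/2`. [folklore] -/
private theorem phi_le (r : ℕ) : phi r ≤ π / 2 := by
  unfold phi
  refine div_le_div_of_nonneg_left pi_pos.le (by norm_num) ?_
  nlinarith [(Nat.cast_nonneg r : (0 : ℝ) ≤ r)]

/-- `(2r+1)φ_r = π/2`. [folklore] -/
private theorem odd_mul_phi (r : ℕ) : (2 * r + 1) * phi r = π / 2 := by
  unfold phi; field_simp

/-- `sin φ_r > 0`. [folklore] -/
private theorem sin_phi_pos (r : ℕ) : 0 < sin (phi r) :=
  sin_pos_of_pos_of_lt_pi (phi_pos r) (by linarith [phi_le r, pi_pos])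

/-- `sin φ_r ≤ φ_r`. [folklore] -/
private theorem sin_phi_le_phi (r : ℕ) : sin (phi r) ≤ phi r := sin_le (phi_pos r).le

/-- The rescaling `μ_r(t) = t / sin²φ_r`: the run `(r, μ_r(t))` has `sin²θ = t/μ = sin²φ_r` at
`k = t`, so `(2r+1)θ = π/2` and the failure value vanishes exactly ("exact Grover").
[cite: KaniewskiLeeDewolf2015, App. Thm. 20 (p. 14)] -/
def exactMu (r : ℕ) (t : ℝ) : ℝ := t / sin (phi r) ^ 2

/-- `μ_r(t) > 0` for `t > 0`. [folklore] -/
private theorem exactMu_pos (r : ℕ) {t : ℝ} (ht : 0 < t) : 0 < exactMu r t :=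
  div_pos ht (pow_pos (sin_phi_pos r) 2)

/-- `t/μ_r(t) = sin²φ_r`. [cite: KaniewskiLeeDewolf2015, App. Thm. 20 (p. 14)] -/
theorem div_exactMu (r : ℕ) {t : ℝ} (ht : t ≠ 0) : t / exactMu r t = sin (phi r) ^ 2 := by
  unfold exactMu
  rw [div_div_eq_mul_div, mul_div_cancel_left₀ _ ht]

/-- **Exactness:** `fail_r(μ_r(t), t) = cos²(π/2) = 0`. [cite: KaniewskiLeeDewolf2015, App. Thm. 20 (p. 14: "finds a solution with certainty if |z| = t")] -/
theorem fail_exactMu_self (r : ℕ) {t : ℝ} (ht : 0 < t) : fail r (exactMu r t) t = 0 := by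
  unfold fail
  rw [div_exactMu r ht.ne', ← cos_sq' (phi r)]
  have h := cos_odd_mul r (phi r)
  rw [odd_mul_phi, cos_pi_div_two] at h
  have : cos (phi r) ^ 2 * eval (cos (phi r) ^ 2) (a r) ^ 2 =
      (cos (phi r) * eval (cos (phi r) ^ 2) (a r)) ^ 2 := by ring
  rw [this, ← h]; norm_num

/-- The iteration count `r(m,t) = ⌈(π/4)√(m/t)⌉` ("Grover with `O(√(m/t))` queries").
[cite: KaniewskiLeeDewolf2015, App. Thm. 20 (p. 14)] -/
def iter (m t : ℝ) : ℕ := ⌈π / 4 * sqrt (m / t)⌉₊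

/-- `r(m,t) ≤ (π/4)√(m/t) + 1`. [cite: KaniewskiLeeDewolf2015, App. Thm. 20 (p. 14: "O(√(m/t)) queries")] -/
theorem iter_le (m t : ℝ) : (iter m t : ℝ) ≤ π / 4 * sqrt (m / t) + 1 :=
  (Nat.ceil_lt_add_one (by positivity)).le

/-- `r(m,t) ≤ √(m/t) + 1`. [cite: KaniewskiLeeDewolf2015, App. Thm. 20 (p. 14: "O(√(m/t)) queries")] -/
theorem iter_le' {m t : ℝ} : (iter m t : ℝ) ≤ sqrt (m / t) + 1 := by
  have h := iter_le m t
  have hπ : π / 4 ≤ 1 := by linarith [pi_lt_four]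
  nlinarith [sqrt_nonneg (m / t)]

/-- `(π/4)√(m/t) ≤ r(m,t)`. [folklore] -/
private theorem le_iter (m t : ℝ) : π / 4 * sqrt (m / t) ≤ iter m t := Nat.le_ceil _

/-- With `r = r(m,t)` the rescaling is at least `m`: `μ_r(t) ≥ m` (so that `(m − k)/μ ≥ 0` splits off
a nonnegative constant — the ancilla of exact Grover). [cite: KaniewskiLeeDewolf2015, App. Thm. 20 (p. 14)] -/
theorem le_exactMu_iter {m t : ℝ} (hm : 0 ≤ m) (ht : 0 < t) : m ≤ exactMu (iter m t) t := by
  set r := iter m t with hr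
  have hs := sin_phi_pos r
  unfold exactMu
  rw [le_div_iff₀ (pow_pos hs 2)]
  rcases eq_or_lt_of_le hm with hm0 | hm'
  · rw [← hm0, zero_mul]; exact ht.le
  -- `m sin²φ ≤ m φ² ≤ t`
  have h1 : π / 2 * sqrt (m / t) ≤ 2 * (r : ℝ) + 1 := by
    have := le_iter m t; rw [← hr] at this; linarith
  have hφ : phi r ≤ sqrt (t / m) := by
    unfold phi
    rw [div_le_iff₀ (by positivity)]
    calc π = π / 2 * sqrt (m / t) * (2 * sqrt (t / m)) := by
          rw [show π / 2 * sqrt (m / t) * (2 * sqrt (t / m)) = π * (sqrt (m / t) * sqrt (t / m)) by ring,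
            ← sqrt_mul (div_nonneg hm ht.le), div_mul_div_comm, mul_comm m t,
            div_self (by positivity), sqrt_one, mul_one]
      _ ≤ (2 * r + 1) * (2 * sqrt (t / m)) := by gcongr
      _ = sqrt (t / m) * (2 * (2 * r + 1)) := by ring
  have h2 : sin (phi r) ^ 2 ≤ t / m :=
    calc sin (phi r) ^ 2 ≤ phi r ^ 2 := pow_le_pow_left₀ hs.le (sin_phi_le_phi r) 2
      _ ≤ sqrt (t / m) ^ 2 := pow_le_pow_left₀ (phi_pos r).le hφ 2
      _ = t / m := sq_sqrt (div_nonneg ht.le hm)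
  calc m * sin (phi r) ^ 2 ≤ m * (t / m) := by gcongr
    _ = t := by field_simp

/-! ### The window bound: `fail ≤ 15/16` on `t ≤ k ≤ 1.21·t` -/

/-- Numerical core: for `π/2 ≤ ψ ≤ (11/10)·π²/4`, `cos²ψ ≤ 15/16`
(`sin ψ = sin(π − ψ) ≥ (2/π)(π − ψ) ≥ (40 − 11π)/20 ≥ 1/4`). [folklore] -/
private theorem cos_sq_le_of_mem_window {ψ : ℝ} (h1 : π / 2 ≤ ψ) (h2 : ψ ≤ 11 / 10 * (π / 2) * (π / 2)) :
    cos ψ ^ 2 ≤ 15 / 16 := by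
  have hπ1 : 3.14 < π := pi_gt_d2
  have hπ2 : π < 3.15 := pi_lt_d2
  have hx0 : 0 ≤ π - ψ := by nlinarith
  have hx1 : π - ψ ≤ π / 2 := by linarith
  have hj : 2 / π * (π - ψ) ≤ sin (π - ψ) := mul_le_sin hx0 hx1
  rw [sin_pi_sub] at hj
  have hlow : (1 : ℝ) / 4 ≤ 2 / π * (π - ψ) := by
    rw [div_mul_eq_mul_div, le_div_iff₀ pi_pos]
    nlinarith
  have hs : 1 / 4 ≤ sin ψ := hlow.trans hj
  have : sin ψ ^ 2 ≥ 1 / 16 := by nlinarith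
  rw [cos_sq']; linarith

/-- **Window bound** ("Grover that assumes `|z| ∈ [2^i, 2^{i+1}]` finds a solution with probability
`≥ 1/2`", here with ratio `1.21` and constant `1/16`): for `0 < t ≤ k ≤ 1.21 t`, `k ≤ μ_r(t)`, the run
`(r, μ_r(t))` has failure value `≤ 15/16`. [cite: KaniewskiLeeDewolf2015, App. Thm. 20 (p. 14)] -/
theorem fail_exactMu_le {r : ℕ} {t k : ℝ} (ht : 0 < t) (htk : t ≤ k) (hk : k ≤ 121 / 100 * t)
    (hkμ : k ≤ exactMu r t) : fail r (exactMu r t) k ≤ 15 / 16 := by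
  set μ := exactMu r t with hμdef
  have hμ : 0 < μ := exactMu_pos r ht
  have hk0 : 0 ≤ k := ht.le.trans htk
  rw [fail_eq_cos_sq r hμ hk0 hkμ]
  set θ := arcsin (sqrt (k / μ)) with hθ
  have hsφ : sqrt (t / μ) = sin (phi r) := by
    rw [hμdef, div_exactMu r ht.ne', sqrt_sq (sin_phi_pos r).le]
  have hu1 : sqrt (k / μ) ≤ 1 := by rw [sqrt_le_one]; exact (div_le_one hμ).2 hkμ
  have hθ0 : 0 ≤ θ := arcsin_nonneg.2 (sqrt_nonneg _)
  have hθ1 : θ ≤ π / 2 := arcsin_le_pi_div_two _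
  have hsinθ : sin θ = sqrt (k / μ) := sin_arcsin (by linarith [sqrt_nonneg (k / μ)]) hu1
  -- lower bound `θ ≥ φ`
  have hθφ : phi r ≤ θ := by
    have : arcsin (sin (phi r)) ≤ θ := by
      apply monotone_arcsin
      rw [← hsφ]; exact sqrt_le_sqrt (by gcongr)
    rwa [arcsin_sin (by linarith [phi_pos r, pi_pos]) (phi_le r)] at this
  -- upper bound `θ ≤ (π/2)·(11/10)·φ`
  have hθup : θ ≤ π / 2 * (11 / 10 * phi r) := by
    have hj : 2 / π * θ ≤ sin θ := mul_le_sin hθ0 hθ1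
    have hsk : sqrt (k / μ) ≤ 11 / 10 * sqrt (t / μ) := by
      calc sqrt (k / μ) ≤ sqrt (121 / 100 * (t / μ)) := sqrt_le_sqrt (by
              rw [← mul_div_assoc]; gcongr)
        _ = sqrt (121 / 100) * sqrt (t / μ) := sqrt_mul (by norm_num) _
        _ = 11 / 10 * sqrt (t / μ) := by
            congr 1
            rw [show (121 : ℝ) / 100 = (11 / 10) ^ 2 by norm_num, sqrt_sq (by norm_num)]
    have h3 : sin θ ≤ 11 / 10 * phi r := by
      rw [hsinθ]; calc sqrt (k / μ) ≤ 11 / 10 * sqrt (t / μ) := hsk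
        _ = 11 / 10 * sin (phi r) := by rw [hsφ]
        _ ≤ 11 / 10 * phi r := by gcongr; exact sin_phi_le_phi r
    have h4 : 2 / π * θ ≤ 11 / 10 * phi r := hj.trans h3
    rw [div_mul_eq_mul_div, div_le_iff₀ pi_pos] at h4
    nlinarith [pi_pos]
  apply cos_sq_le_of_mem_window
  · calc π / 2 = (2 * r + 1) * phi r := (odd_mul_phi r).symm
      _ ≤ (2 * r + 1) * θ := by gcongr
  · calc (2 * (r : ℝ) + 1) * θ ≤ (2 * r + 1) * (π / 2 * (11 / 10 * phi r)) := by gcongr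
      _ = 11 / 10 * (π / 2) * ((2 * r + 1) * phi r) := by ring
      _ = 11 / 10 * (π / 2) * (π / 2) := by rw [odd_mul_phi]

end GroverPolynomial



namespace GroverPolynomial

/-- `deg a_r ≤ r`, `deg b_r ≤ r`. [cite: KaniewskiLeeDewolf2015, Lemma 11 (p. 8: "α_{i,z}(x) is an n-variate multilinear polynomial in x of degree ≤ t")] -/
theorem natDegree_a_b_le (r : ℕ) : (a r).natDegree ≤ r ∧ (b r).natDegree ≤ r := by
  induction r with
  | zero => simp
  | succ r ih =>
    obtain ⟨ha, hb⟩ := ih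
    have h1 : (2 * X - 1 : ℝ[X]).natDegree ≤ 1 := by compute_degree
    have h2 : (2 * (1 - X) : ℝ[X]).natDegree ≤ 1 := by compute_degree
    have h3 : (2 * X : ℝ[X]).natDegree ≤ 1 := by compute_degree
    refine ⟨?_, ?_⟩
    · rw [a_succ]
      refine (natDegree_sub_le _ _).trans (max_le ?_ ?_)
      · exact natDegree_mul_le.trans (by omega)
      · exact natDegree_mul_le.trans (by omega)
    · rw [b_succ]
      refine (natDegree_add_le _ _).trans (max_le ?_ ?_)
      · exact natDegree_mul_le.trans (by omega)
      · exact natDegree_mul_le.trans (by omega)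

/-- `deg a_r ≤ r`. [cite: KaniewskiLeeDewolf2015, Lemma 11 (p. 8)] -/
theorem natDegree_a_le (r : ℕ) : (a r).natDegree ≤ r := (natDegree_a_b_le r).1
/-- `deg b_r ≤ r`. [cite: KaniewskiLeeDewolf2015, Lemma 11 (p. 8)] -/
theorem natDegree_b_le (r : ℕ) : (b r).natDegree ≤ r := (natDegree_a_b_le r).2

/-! ### Runs as sums of squares on the cube -/

variable {N : ℕ}

/-- The rescaled complementary weight `1 − |x∩A|/μ` has degree `≤ 1`. [folklore] -/
private theorem hasDegreeLE_one_sub_wt_div (A : Finset (Fin N)) (μ : ℝ) :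
    HasDegreeLE 1 (fun x => 1 - wt A x / μ) := by
  have h := (HasDegreeLE.const (m := N) 1 1).sub ((hasDegreeLE_wt A).const_mul μ⁻¹)
  convert h using 2 with x
  rw [div_eq_mul_inv, mul_comm]

/-- **The failure value of a run is a sum of squares of degree `r+1` on the cube** when `μ ≥ |A|`:
`(1 − w/μ)·a_r² = ((μ−|A|)/μ)·a_r² + (1/μ)·Σ_{i∈A}((1−x_i)a_r)²` — the second summand is Grover's
"no marked item in the register", the first the ancilla of exact Grover.
[cite: KaniewskiLeeDewolf2015, App. Thm. 20 (p. 14)] -/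
theorem hasSosCertificate_fail (A : Finset (Fin N)) (r : ℕ) {μ : ℝ} (hμ : 0 < μ)
    (hA : (A.card : ℝ) ≤ μ) :
    HasSosCertificate (2 * (r + 1)) (fun x => fail r μ (wt A x)) := by
  set p : (Fin N → Bool) → ℝ := fun x => (a r).eval (1 - wt A x / μ) with hp
  have hpdeg : HasDegreeLE r p :=
    hasDegreeLE_polynomial_eval (hasDegreeLE_one_sub_wt_div A μ) (a r) (natDegree_a_le r)
  have hsplit : (fun x => fail r μ (wt A x)) =
      fun x => (μ - A.card) / μ * p x ^ 2 + 1 / μ * ((A.card - wt A x) * p x ^ 2) := by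
    funext x
    simp only [fail, hp]
    field_simp
    ring
  rw [hsplit]
  refine HasSosCertificate.add ?_ ?_
  · have h := hasSosCertificate_const_mul_sq (div_nonneg (sub_nonneg.2 hA) hμ.le) hpdeg
    exact h.of_degree_le (by omega)
  · exact (hasSosCertificate_card_sub_wt_mul_sq A hpdeg).const_mul (by positivity)

/-- **The paid success value `(w − 1)·succ` is a sum of squares of degree `r+2`:**
`(w−1)(w/μ) b_r² = (1/μ) Σ_{i≠j∈A} (x_i x_j b_r)²` ("if `i` is a solution, query a uniformly random
`j ≠ i` and output `z_j·(m−1)`"). [cite: KaniewskiLeeDewolf2015, App. Thm. 21 (p. 14)] -/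
theorem hasSosCertificate_wt_sub_one_mul_succ (A : Finset (Fin N)) (r : ℕ) {μ : ℝ} (hμ : 0 < μ) :
    HasSosCertificate (2 * (r + 2)) (fun x => (wt A x - 1) * succ r μ (wt A x)) := by
  set q : (Fin N → Bool) → ℝ := fun x => (b r).eval (1 - wt A x / μ) with hq
  have hqdeg : HasDegreeLE r q :=
    hasDegreeLE_polynomial_eval (hasDegreeLE_one_sub_wt_div A μ) (b r) (natDegree_b_le r)
  have hsplit : (fun x => (wt A x - 1) * succ r μ (wt A x)) =
      fun x => 1 / μ * (wt A x * (wt A x - 1) * q x ^ 2) := by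
    funext x
    simp only [succ, hq]
    field_simp
  rw [hsplit]
  exact (hasSosCertificate_wt_mul_wt_sub_one_mul_sq A hqdeg).const_mul (by positivity)

end GroverPolynomial

/-! ## The schedule of runs and the approximating function `F` -/

namespace GroverSchedule

open GroverPolynomial

/-- The scale ratio `ρ = 1.21 = 1.1²`. [cite: KaniewskiLeeDewolf2015, App. Thm. 20 (p. 14: dyadic scales; here ratio 1.21)] -/
def rho : ℝ := 121 / 100

/-- Repetitions per scale, `R = 16(ℓ + L + 3)`. [cite: KaniewskiLeeDewolf2015, App. Thm. 20 (p. 14: "⌈√(ℓ2^{i+1})⌉ times")] -/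
def reps (ℓ L : ℕ) : ℕ := 16 * (ℓ + L + 3)

/-- Number of scales, `4(L+1) + 1` (`ρ⁴ > 2`, so `(ℓ+1)ρ^{4(L+1)} ≥ 2^{L+1} > m`). [cite: KaniewskiLeeDewolf2015, App. Thm. 20 (p. 14: "for i = ⌊log ℓ⌋, …, ⌊log m⌋")] -/
def nScales (L : ℕ) : ℕ := 4 * (L + 1) + 1

/-- The `j`-th scale `t_j = (ℓ+1)ρ^j`. [cite: KaniewskiLeeDewolf2015, App. Thm. 20 (p. 14)] -/
def scaleT (ℓ j : ℕ) : ℝ := (ℓ + 1) * rho ^ j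

/-- Target of the `i`-th run: `i + 1` for the exact runs `i < ℓ`, then the scales, each repeated
`R` times. [cite: KaniewskiLeeDewolf2015, App. Thm. 20 (p. 14)] -/
def target (ℓ L i : ℕ) : ℝ := if i < ℓ then (i : ℝ) + 1 else scaleT ℓ ((i - ℓ) / reps ℓ L)

/-- Total number of runs. [cite: KaniewskiLeeDewolf2015, App. Thm. 20 (p. 14)] -/
def total (ℓ L : ℕ) : ℕ := ℓ + nScales L * reps ℓ L

/-- The `i`-th run `(r_i, μ_i) = (r(m,t_i), μ_{r_i}(t_i))`. [cite: KaniewskiLeeDewolf2015, App. Thm. 20 (p. 14)] -/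
def runR (m ℓ L i : ℕ) : ℕ := iter m (target ℓ L i)

/-- The rescaling of the `i`-th run. [cite: KaniewskiLeeDewolf2015, App. Thm. 20 (p. 14)] -/
def runMu (m ℓ L i : ℕ) : ℝ := exactMu (runR m ℓ L i) (target ℓ L i)

/-- The failure value of the `i`-th run at weight `k`. [cite: KaniewskiLeeDewolf2015, App. Thm. 20 (p. 14)] -/
def failAt (m ℓ L i : ℕ) (k : ℝ) : ℝ := fail (runR m ℓ L i) (runMu m ℓ L i) k

/-- Probability that every run fails, `Π_i fail_i(k)`. [cite: KaniewskiLeeDewolf2015, App. Thm. 21 proof (p. 14: "If it did not find a solution the algorithm outputs 0")] -/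
def prodFail (m ℓ L : ℕ) (k : ℝ) : ℝ := ∏ i ∈ Finset.range (total ℓ L), failAt m ℓ L i k

/-- **The approximating function** `F(k) = (k − 1)·(1 − Π_i fail_i(k))` = expected output of the
de-quantised Theorem-21 algorithm. [cite: KaniewskiLeeDewolf2015, App. Thm. 21 (p. 14)] -/
def F (m ℓ L : ℕ) (k : ℝ) : ℝ := (k - 1) * (1 - prodFail m ℓ L k)

/-- Half the degree of the sos certificate of `F`: `1 + Σ_i (r_i + 1)` ("total number of queries").
[cite: KaniewskiLeeDewolf2015, App. Thm. 20 (p. 14: "the overall query complexity is O(√(mℓ) log m)")] -/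
def halfDeg (m ℓ L : ℕ) : ℕ := 1 + ∑ i ∈ Finset.range (total ℓ L), (runR m ℓ L i + 1)

/-- `ρ > 0`. [folklore] -/
private theorem rho_pos : 0 < rho := by unfold rho; norm_num
/-- `ρ ≥ 1`. [folklore] -/
private theorem one_le_rho : 1 ≤ rho := by unfold rho; norm_num

/-- `R > 0`. [folklore] -/
private theorem reps_pos (ℓ L : ℕ) : 0 < reps ℓ L := by unfold reps; omega

/-- `t_j > 0`. [folklore] -/
private theorem scaleT_pos (ℓ j : ℕ) : 0 < scaleT ℓ j := by
  unfold scaleT; exact mul_pos (by positivity) (pow_pos rho_pos j)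

/-- Every target is positive. [folklore] -/
private theorem target_pos (ℓ L i : ℕ) : 0 < target ℓ L i := by
  unfold target; split_ifs
  · positivity
  · exact scaleT_pos _ _

/-- Every rescaling is positive. [folklore] -/
private theorem runMu_pos (m ℓ L i : ℕ) : 0 < runMu m ℓ L i := exactMu_pos _ (target_pos ℓ L i)

/-- Every rescaling is at least `m`. [cite: KaniewskiLeeDewolf2015, App. Thm. 20 (p. 14)] -/
theorem le_runMu (m ℓ L i : ℕ) : (m : ℝ) ≤ runMu m ℓ L i :=
  le_exactMu_iter (Nat.cast_nonneg m) (target_pos ℓ L i)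

/-- Failure values are nonnegative on `k ≤ m`. [cite: KaniewskiLeeDewolf2015, App. Thm. 20 (p. 14)] -/
theorem failAt_nonneg {m ℓ L : ℕ} (i : ℕ) {k : ℝ} (hk : k ≤ m) : 0 ≤ failAt m ℓ L i k :=
  fail_nonneg _ (runMu_pos m ℓ L i) (hk.trans (le_runMu m ℓ L i))

/-- Failure values are at most one on `k ≥ 0`. [cite: KaniewskiLeeDewolf2015, App. Thm. 20 (p. 14)] -/
theorem failAt_le_one {m ℓ L : ℕ} (i : ℕ) {k : ℝ} (hk : 0 ≤ k) : failAt m ℓ L i k ≤ 1 :=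
  fail_le_one _ (runMu_pos m ℓ L i) hk

/-- `0 ≤ Π fail` on `k ≤ m`. [cite: KaniewskiLeeDewolf2015, App. Thm. 21 (p. 14)] -/
theorem prodFail_nonneg {m ℓ L : ℕ} {k : ℝ} (hk : k ≤ m) : 0 ≤ prodFail m ℓ L k :=
  Finset.prod_nonneg fun i _ => failAt_nonneg i hk

/-- `Π fail ≤ 1` on `0 ≤ k ≤ m`. [cite: KaniewskiLeeDewolf2015, App. Thm. 21 (p. 14)] -/
theorem prodFail_le_one {m ℓ L : ℕ} {k : ℝ} (hk0 : 0 ≤ k) (hk : k ≤ m) : prodFail m ℓ L k ≤ 1 :=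
  Finset.prod_le_one (fun i _ => failAt_nonneg i hk) fun i _ => failAt_le_one i hk0

/-- `F ≤ k − 1` on `1 ≤ k ≤ m` (the output never exceeds `|z| − 1` in expectation). [cite: KaniewskiLeeDewolf2015, App. Thm. 21 (p. 14)] -/
theorem F_le {m ℓ L : ℕ} {k : ℝ} (hk1 : 1 ≤ k) (hk : k ≤ m) : F m ℓ L k ≤ k - 1 := by
  unfold F
  have h := prodFail_nonneg (m := m) (ℓ := ℓ) (L := L) hk
  nlinarith

/-- Telescoping: `1 − Π_{i<T} f_i = Σ_{i<T} (1 − f_i) Π_{j<i} f_j` (first successful run).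
[cite: KaniewskiLeeDewolf2015, App. Thm. 21 proof (p. 14)] -/
theorem one_sub_prod_range (f : ℕ → ℝ) (T : ℕ) :
    1 - ∏ i ∈ Finset.range T, f i =
      ∑ i ∈ Finset.range T, (1 - f i) * ∏ j ∈ Finset.range i, f j := by
  induction T with
  | zero => simp
  | succ T ih =>
    rw [Finset.prod_range_succ, Finset.sum_range_succ, ← ih]
    ring

/-- `F` as the expected payout summed over the first successful run:
`F(k) = Σ_i [(k−1)·succ_i(k)] · Π_{j<i} fail_j(k)`. [cite: KaniewskiLeeDewolf2015, App. Thm. 21 proof (p. 14)] -/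
theorem F_eq_sum (m ℓ L : ℕ) (k : ℝ) :
    F m ℓ L k = ∑ i ∈ Finset.range (total ℓ L),
      ((k - 1) * succ (runR m ℓ L i) (runMu m ℓ L i) k) *
        ∏ j ∈ Finset.range i, failAt m ℓ L j k := by
  unfold F prodFail
  rw [one_sub_prod_range, Finset.mul_sum]
  refine Finset.sum_congr rfl fun i _ => ?_
  have h := fail_add_succ (runR m ℓ L i) (runMu m ℓ L i) k
  unfold failAt
  rw [show 1 - fail (runR m ℓ L i) (runMu m ℓ L i) k = succ (runR m ℓ L i) (runMu m ℓ L i) k by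
    linarith]
  ring

variable {N : ℕ}

/-- Finite products of sos certificates (degrees add). [cite: KaniewskiLeeDewolf2015, Thm. 18 proof (p. 12)] -/
theorem hasSosCertificate_prod {ι : Type*} (s : Finset ι) {d : ι → ℕ}
    {f : ι → (Fin N → Bool) → ℝ} (hf : ∀ i ∈ s, HasSosCertificate (d i) (f i)) :
    HasSosCertificate (∑ i ∈ s, d i) (fun x => ∏ i ∈ s, f i x) := by
  classical
  induction s using Finset.induction_on with
  | empty => simpa using HasSosCertificate.one (m := N) 0
  | insert a s ha ih =>
    have h := (hf a (Finset.mem_insert_self _ _)).mul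
      (ih fun i hi => hf i (Finset.mem_insert_of_mem hi))
    rw [Finset.sum_insert ha]
    convert h using 2 with x
    rw [Finset.prod_insert ha]

/-- **The sos certificate of `F` on the cube** (the polynomial method, Theorem 3, applied to the
algorithm of Theorem 21): for `|A| = m`, `x ↦ F(|x ∩ A|)` is a sum of squares of functions of degree
`≤ halfDeg = 1 + Σ_i (r_i + 1)`. [cite: KaniewskiLeeDewolf2015, Thm. 12 (p. 8) and App. Thm. 21 (p. 14)] -/
theorem hasSosCertificate_F (m ℓ L : ℕ) (A : Finset (Fin N)) (hA : A.card = m) :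
    HasSosCertificate (2 * halfDeg m ℓ L) (fun x => F m ℓ L (wt A x)) := by
  have hAμ : ∀ i, (A.card : ℝ) ≤ runMu m ℓ L i := fun i => by rw [hA]; exact le_runMu m ℓ L i
  have hterm : ∀ i ∈ Finset.range (total ℓ L), HasSosCertificate (2 * halfDeg m ℓ L)
      (fun x => ((wt A x - 1) * succ (runR m ℓ L i) (runMu m ℓ L i) (wt A x)) *
        ∏ j ∈ Finset.range i, failAt m ℓ L j (wt A x)) := by
    intro i hi
    have h1 := hasSosCertificate_wt_sub_one_mul_succ A (runR m ℓ L i) (runMu_pos m ℓ L i)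
    have h2 : HasSosCertificate (∑ j ∈ Finset.range i, 2 * (runR m ℓ L j + 1))
        (fun x => ∏ j ∈ Finset.range i, failAt m ℓ L j (wt A x)) :=
      hasSosCertificate_prod (Finset.range i) fun j _ =>
        hasSosCertificate_fail A (runR m ℓ L j) (runMu_pos m ℓ L j) (hAμ j)
    refine (h1.mul h2).of_degree_le ?_
    -- degree bookkeeping: `2(r_i+2) + Σ_{j<i} 2(r_j+1) ≤ 2(1 + Σ_{j<T}(r_j+1))`
    have hsub : ∑ j ∈ Finset.range i, (runR m ℓ L j + 1) + (runR m ℓ L i + 1) ≤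
        ∑ j ∈ Finset.range (total ℓ L), (runR m ℓ L j + 1) := by
      rw [← Finset.sum_range_succ (fun j => runR m ℓ L j + 1) i]
      exact Finset.sum_le_sum_of_subset (Finset.range_mono (Finset.mem_range.1 hi))
    unfold halfDeg
    rw [← Finset.mul_sum]
    omega
  have h := HasSosCertificate.sum (Finset.range (total ℓ L)) hterm
  convert h using 2 with x
  rw [F_eq_sum]

end GroverSchedule


namespace GroverSchedule

open GroverPolynomial

/-! ### Exactness below the threshold -/

/-- For `i < ℓ` the `i`-th run is the exact run with target `i + 1`. [cite: KaniewskiLeeDewolf2015, App. Thm. 20 (p. 14: "Run exact Grover ℓ times, once for each of the possibilities t = 1, …, ℓ")] -/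
theorem target_of_lt {ℓ L i : ℕ} (hi : i < ℓ) : target ℓ L i = (i : ℝ) + 1 := by
  unfold target; rw [if_pos hi]

/-- **Exactness:** for integer `1 ≤ k ≤ ℓ`, `Π_i fail_i(k) = 0` and `F(k) = k − 1` ("If `|z| ∈ {1,…,ℓ}`
then … the expected value of the output is `|z| − 1`"). [cite: KaniewskiLeeDewolf2015, App. Thm. 21 (p. 14)] -/
theorem prodFail_eq_zero {m ℓ L k : ℕ} (hk1 : 1 ≤ k) (hkℓ : k ≤ ℓ) : prodFail m ℓ L k = 0 := by
  unfold prodFail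
  apply Finset.prod_eq_zero (i := k - 1) (Finset.mem_range.2 (by unfold total; omega))
  unfold failAt runMu runR
  have ht : target ℓ L (k - 1) = (k : ℝ) := by
    rw [target_of_lt (by omega)]
    norm_cast; omega
  rw [ht]
  exact fail_exactMu_self _ (by exact_mod_cast hk1)

/-- **Exactness of `F`:** `F(k) = k − 1` for integer `1 ≤ k ≤ ℓ`. [cite: KaniewskiLeeDewolf2015, App. Thm. 21 (p. 14)] -/
theorem F_eq_of_le {m ℓ L k : ℕ} (hk1 : 1 ≤ k) (hkℓ : k ≤ ℓ) : F m ℓ L k = k - 1 := by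
  unfold F; rw [prodFail_eq_zero hk1 hkℓ]; ring

/-! ### The approximation above the threshold -/

/-- Runs in the `j`-th block are the scale-`j` runs. [cite: KaniewskiLeeDewolf2015, App. Thm. 20 (p. 14)] -/
theorem target_of_block {ℓ L j c : ℕ} (hc : c < reps ℓ L) :
    target ℓ L (ℓ + j * reps ℓ L + c) = scaleT ℓ j := by
  unfold target
  rw [if_neg (by omega)]
  congr 1
  have : ℓ + j * reps ℓ L + c - ℓ = j * reps ℓ L + c := by omega
  rw [this, Nat.add_comm, Nat.add_mul_div_right _ _ (reps_pos ℓ L), Nat.div_eq_of_lt hc, zero_add]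

/-- `ρ⁴ ≥ 2`, hence `ρ^{4(L+1)} ≥ 2^{L+1}`. [folklore] -/
private theorem two_pow_le_rho_pow (L : ℕ) : (2 : ℝ) ^ (L + 1) ≤ rho ^ (4 * (L + 1)) := by
  rw [pow_mul]
  exact pow_le_pow_left₀ (by norm_num) (by unfold rho; norm_num) _

/-- **Scale selection:** every `k` with `ℓ + 1 ≤ k ≤ m < 2^{L+1}` lies in a window
`[t_j, ρ t_j]` for some scale `j` ("let `i` be the unique integer such that `|z| ∈ [2^i, 2^{i+1})`").
[cite: KaniewskiLeeDewolf2015, App. Thm. 20 proof (p. 14)] -/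
theorem exists_scale {m ℓ L : ℕ} {k : ℝ} (hkℓ : (ℓ : ℝ) + 1 ≤ k) (hkm : k ≤ m)
    (hmL : m < 2 ^ (L + 1)) :
    ∃ j, j < nScales L ∧ scaleT ℓ j ≤ k ∧ k ≤ rho * scaleT ℓ j := by
  classical
  let P : ℕ → Prop := fun j => scaleT ℓ j ≤ k
  have hP0 : P 0 := by show scaleT ℓ 0 ≤ k; unfold scaleT; simpa using hkℓ
  set j := Nat.findGreatest P (4 * (L + 1)) with hj
  have hjle : j ≤ 4 * (L + 1) := Nat.findGreatest_le _
  have hPj : P j := Nat.findGreatest_spec (Nat.zero_le _) hP0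
  refine ⟨j, by unfold nScales; omega, hPj, ?_⟩
  have hm2 : (m : ℝ) < 2 ^ (L + 1) := by exact_mod_cast hmL
  rcases lt_or_eq_of_le hjle with hlt | heq
  · have hnot : ¬ P (j + 1) := Nat.findGreatest_is_greatest (Nat.lt_succ_self _) hlt
    have : k < scaleT ℓ (j + 1) := lt_of_not_ge hnot
    unfold scaleT at this ⊢
    rw [pow_succ] at this
    linarith
  · -- the top scale already exceeds `m`
    have hbig : (m : ℝ) ≤ scaleT ℓ j := by
      unfold scaleT
      rw [heq]
      calc (m : ℝ) ≤ 2 ^ (L + 1) := hm2.le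
        _ ≤ rho ^ (4 * (L + 1)) := two_pow_le_rho_pow L
        _ ≤ (ℓ + 1) * rho ^ (4 * (L + 1)) := by
            refine le_mul_of_one_le_left (pow_pos rho_pos _).le ?_
            linarith [(Nat.cast_nonneg ℓ : (0 : ℝ) ≤ ℓ)]
    calc k ≤ m := hkm
      _ ≤ scaleT ℓ j := hbig
      _ ≤ rho * scaleT ℓ j := le_mul_of_one_le_left (scaleT_pos ℓ j).le one_le_rho

/-- **All-fail probability above the threshold:** for `ℓ+1 ≤ k ≤ m < 2^{L+1}`,
`Π_i fail_i(k) ≤ (15/16)^R` (the `R` runs of the right scale each fail with probability `≤ 15/16`).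
[cite: KaniewskiLeeDewolf2015, App. Thm. 20 (p. 14: "the probability of not finding a solution is ≤ 2^{−⌈√(ℓ2^{i+1})⌉}")] -/
theorem prodFail_le {m ℓ L : ℕ} {k : ℝ} (hkℓ : (ℓ : ℝ) + 1 ≤ k) (hkm : k ≤ m)
    (hmL : m < 2 ^ (L + 1)) : prodFail m ℓ L k ≤ (15 / 16 : ℝ) ^ reps ℓ L := by
  classical
  obtain ⟨j, hj, htk, hkt⟩ := exists_scale hkℓ hkm hmL
  have hk0 : 0 ≤ k := by linarith [(Nat.cast_nonneg ℓ : (0 : ℝ) ≤ ℓ)]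
  set W : Finset ℕ := Finset.Ico (ℓ + j * reps ℓ L) (ℓ + j * reps ℓ L + reps ℓ L) with hW
  have hWsub : W ⊆ Finset.range (total ℓ L) := by
    intro i hi
    rw [hW, Finset.mem_Ico] at hi
    rw [Finset.mem_range]
    unfold total
    have : (j + 1) * reps ℓ L ≤ nScales L * reps ℓ L := Nat.mul_le_mul_right _ hj
    nlinarith
  have hWfail : ∀ i ∈ W, failAt m ℓ L i k ≤ 15 / 16 := by
    intro i hi
    rw [hW, Finset.mem_Ico] at hi
    obtain ⟨c, hc, rfl⟩ : ∃ c, c < reps ℓ L ∧ i = ℓ + j * reps ℓ L + c :=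
      ⟨i - (ℓ + j * reps ℓ L), by omega, by omega⟩
    unfold failAt runMu runR
    rw [target_of_block hc]
    refine fail_exactMu_le (scaleT_pos ℓ j) htk ?_ ?_
    · unfold rho at hkt; linarith
    · rw [← target_of_block (ℓ := ℓ) (L := L) (j := j) hc]
      exact hkm.trans (le_runMu m ℓ L _)
  unfold prodFail
  calc ∏ i ∈ Finset.range (total ℓ L), failAt m ℓ L i k
      ≤ ∏ i ∈ Finset.range (total ℓ L), (if i ∈ W then (15 / 16 : ℝ) else 1) := by
        refine Finset.prod_le_prod (fun i _ => failAt_nonneg i hkm) fun i _ => ?_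
        split_ifs with h
        · exact hWfail i h
        · exact failAt_le_one i hk0
    _ = (15 / 16 : ℝ) ^ reps ℓ L := by
        rw [Finset.prod_ite_mem, Finset.inter_eq_right.2 hWsub, Finset.prod_const]
        congr 1
        rw [hW, Nat.card_Ico]; omega

/-- `(15/16)^16 ≤ 1/2`. [folklore] -/
private theorem fifteen_sixteenths_pow : (15 / 16 : ℝ) ^ 16 ≤ 1 / 2 := by norm_num

/-- **The one-sided error bound:** for `ℓ+1 ≤ k ≤ m < 2^{L+1}`,
`0 ≤ (k−1)·Π_i fail_i(k) ≤ 2^{−(ℓ+1)}`, i.e. `k − 1 − 2^{−(ℓ+1)} ≤ F(k) ≤ k − 1`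
("If `|z| > ℓ` then `|z| − 1 − 2^{−m^{2ε}} ≤ f(z) ≤ |z| − 1`").
[cite: KaniewskiLeeDewolf2015, App. Thm. 21 (p. 14)] -/
theorem sub_le_F {m ℓ L : ℕ} {k : ℝ} (hkℓ : (ℓ : ℝ) + 1 ≤ k) (hkm : k ≤ m) (hmL : m < 2 ^ (L + 1)) :
    k - 1 - (1 / 2 : ℝ) ^ (ℓ + 1) ≤ F m ℓ L k := by
  have hP := prodFail_le hkℓ hkm hmL
  have hP0 := prodFail_nonneg (m := m) (ℓ := ℓ) (L := L) hkm
  have hk1 : 0 ≤ k - 1 := by linarith [(Nat.cast_nonneg ℓ : (0 : ℝ) ≤ ℓ)]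
  have hm2 : (m : ℝ) < 2 ^ (L + 1) := by exact_mod_cast hmL
  -- `(15/16)^R ≤ (1/2)^{ℓ+L+3}`
  have hR : (15 / 16 : ℝ) ^ reps ℓ L ≤ (1 / 2 : ℝ) ^ (ℓ + L + 3) := by
    unfold reps
    rw [pow_mul]
    exact pow_le_pow_left₀ (by positivity) fifteen_sixteenths_pow _
  have hkey : (k - 1) * prodFail m ℓ L k ≤ (1 / 2 : ℝ) ^ (ℓ + 1) := by
    calc (k - 1) * prodFail m ℓ L k ≤ (m : ℝ) * (1 / 2 : ℝ) ^ (ℓ + L + 3) := by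
          apply mul_le_mul (by linarith) (hP.trans hR) hP0 (Nat.cast_nonneg m)
      _ = ((m : ℝ) * (1 / 2) ^ (L + 1)) * ((1 / 2) ^ (ℓ + 1) * (1 / 2)) := by ring
      _ ≤ 1 * ((1 / 2 : ℝ) ^ (ℓ + 1) * 1) := by
          apply mul_le_mul _ _ (by positivity) zero_le_one
          · rw [_root_.one_div_pow, mul_one_div, div_le_one (by positivity)]; exact hm2.le
          · apply mul_le_mul_of_nonneg_left (by norm_num) (by positivity)
      _ = (1 / 2 : ℝ) ^ (ℓ + 1) := by ring
  unfold F
  nlinarith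

/-! ### The degree count -/

/-- `Σ_{t=1}^{ℓ} 1/√t ≤ 2√ℓ`. [folklore] -/
private theorem sum_inv_sqrt_le (ℓ : ℕ) :
    ∑ i ∈ Finset.range ℓ, 1 / sqrt ((i : ℝ) + 1) ≤ 2 * sqrt ℓ := by
  induction ℓ with
  | zero => simp
  | succ n ih =>
    rw [Finset.sum_range_succ]
    have hn : (0 : ℝ) ≤ n := Nat.cast_nonneg n
    have hs1 : 0 < sqrt ((n : ℝ) + 1) := sqrt_pos.2 (by linarith)
    -- `1/√(n+1) ≤ 2(√(n+1) − √n)` since `√n √(n+1) ≤ n + 1/2`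
    have hgm : sqrt (n : ℝ) * sqrt ((n : ℝ) + 1) ≤ n + 1 / 2 := by
      rw [← sqrt_mul hn]
      calc sqrt ((n : ℝ) * (n + 1)) ≤ sqrt ((n + 1 / 2) ^ 2) := sqrt_le_sqrt (by nlinarith)
        _ = n + 1 / 2 := sqrt_sq (by linarith)
    have hstep : 1 / sqrt ((n : ℝ) + 1) ≤ 2 * (sqrt ((n : ℝ) + 1) - sqrt n) := by
      rw [div_le_iff₀ hs1]
      have h1 : sqrt ((n : ℝ) + 1) * sqrt ((n : ℝ) + 1) = n + 1 := mul_self_sqrt (by linarith)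
      nlinarith
    push_cast
    linarith

/-- Finite geometric sums with ratio `10/11` are at most `11`. [folklore] -/
private theorem geom_sum_ten_elevenths_le (n : ℕ) : ∑ j ∈ Finset.range n, (10 / 11 : ℝ) ^ j ≤ 11 := by
  have h := geom_sum_mul_neg (10 / 11 : ℝ) n
  have hpos : (0 : ℝ) ≤ (10 / 11 : ℝ) ^ n := by positivity
  nlinarith

/-- Block sums: `Σ_{c < a·b} h(⌊c/b⌋) = b · Σ_{j<a} h(j)`. [folklore] -/
private theorem sum_range_mul_div {b : ℕ} (hb : 0 < b) (h : ℕ → ℝ) (a : ℕ) :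
    ∑ c ∈ Finset.range (a * b), h (c / b) = b * ∑ j ∈ Finset.range a, h j := by
  induction a with
  | zero => simp
  | succ a ih =>
    rw [Nat.succ_mul, Finset.sum_range_succ, mul_add, ← ih, ← Finset.sum_range_add_sum_Ico _
      (Nat.le_add_right (a * b) b)]
    congr 1
    have : ∀ c ∈ Finset.Ico (a * b) (a * b + b), h (c / b) = h a := by
      intro c hc
      rw [Finset.mem_Ico] at hc
      obtain ⟨d, hd, rfl⟩ : ∃ d, d < b ∧ c = a * b + d := ⟨c - a * b, by omega, by omega⟩
      rw [Nat.add_comm, Nat.add_mul_div_right _ _ hb, Nat.div_eq_of_lt hd, zero_add]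
    rw [Finset.sum_congr rfl this, Finset.sum_const, Nat.card_Ico, Nat.add_sub_cancel_left,
      nsmul_eq_mul]

/-- `√(ρ^j) = (11/10)^j`. [folklore] -/
private theorem sqrt_rho_pow (j : ℕ) : sqrt (rho ^ j) = (11 / 10 : ℝ) ^ j := by
  rw [show rho = (11 / 10 : ℝ) ^ 2 by unfold rho; norm_num, ← pow_mul, mul_comm, pow_mul,
    sqrt_sq (by positivity)]

/-- **The query count:** `halfDeg ≤ 1 + 2√m√ℓ + 2ℓ + R·(11√(m/(ℓ+1)) + 2·#scales)`
("`Σ_{t=1}^ℓ O(√(m/t)) = O(√(mℓ))`" and "`Σ_i ⌈√(ℓ2^{i+1})⌉ O(√(m/2^i)) = O(√(mℓ) log m)`").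
[cite: KaniewskiLeeDewolf2015, App. Thm. 20 proof (p. 14)] -/
theorem halfDeg_le (m ℓ L : ℕ) :
    (halfDeg m ℓ L : ℝ) ≤ 1 + (2 * sqrt m * sqrt ℓ + 2 * ℓ) +
      reps ℓ L * (11 * sqrt ((m : ℝ) / (ℓ + 1)) + 2 * nScales L) := by
  have hiter : ∀ t : ℝ, 0 < t → ((iter m t : ℕ) : ℝ) + 1 ≤ sqrt m / sqrt t + 2 := by
    intro t ht
    have := iter_le' (m := (m : ℝ)) (t := t)
    rw [sqrt_div (Nat.cast_nonneg m)] at this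
    linarith
  unfold halfDeg total
  push_cast
  rw [← Finset.sum_range_add_sum_Ico _ (Nat.le_add_right ℓ (nScales L * reps ℓ L))]
  -- exact runs
  have hex : ∑ i ∈ Finset.range ℓ, (((runR m ℓ L i : ℕ) : ℝ) + 1) ≤ 2 * sqrt m * sqrt ℓ + 2 * ℓ := by
    calc ∑ i ∈ Finset.range ℓ, (((runR m ℓ L i : ℕ) : ℝ) + 1)
        ≤ ∑ i ∈ Finset.range ℓ, (sqrt m * (1 / sqrt ((i : ℝ) + 1)) + 2) := by
          refine Finset.sum_le_sum fun i hi => ?_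
          unfold runR
          rw [target_of_lt (Finset.mem_range.1 hi)]
          have := hiter ((i : ℝ) + 1) (by positivity)
          rw [mul_one_div]; exact this
      _ = sqrt m * ∑ i ∈ Finset.range ℓ, 1 / sqrt ((i : ℝ) + 1) + 2 * ℓ := by
          rw [Finset.sum_add_distrib, Finset.mul_sum, Finset.sum_const, Finset.card_range,
            nsmul_eq_mul]; ring
      _ ≤ sqrt m * (2 * sqrt ℓ) + 2 * ℓ := by
          gcongr; exact sum_inv_sqrt_le ℓ
      _ = 2 * sqrt m * sqrt ℓ + 2 * ℓ := by ring
  -- scale runs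
  have hsc : ∑ i ∈ Finset.Ico ℓ (ℓ + nScales L * reps ℓ L), (((runR m ℓ L i : ℕ) : ℝ) + 1) ≤
      reps ℓ L * (11 * sqrt ((m : ℝ) / (ℓ + 1)) + 2 * nScales L) := by
    rw [Finset.sum_Ico_eq_sum_range, Nat.add_sub_cancel_left]
    have hblk : ∀ c ∈ Finset.range (nScales L * reps ℓ L),
        (((runR m ℓ L (ℓ + c) : ℕ) : ℝ) + 1) ≤
          (fun j : ℕ => sqrt m / sqrt (scaleT ℓ j) + 2) (c / reps ℓ L) := by
      intro c _
      unfold runR target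
      rw [if_neg (by omega), Nat.add_sub_cancel_left]
      exact hiter _ (scaleT_pos ℓ _)
    refine (Finset.sum_le_sum hblk).trans ?_
    have hmd := sum_range_mul_div (reps_pos ℓ L)
      (fun j : ℕ => sqrt m / sqrt (scaleT ℓ j) + 2) (nScales L)
    rw [hmd]
    gcongr
    calc ∑ j ∈ Finset.range (nScales L), (sqrt m / sqrt (scaleT ℓ j) + 2)
        = sqrt ((m : ℝ) / (ℓ + 1)) * ∑ j ∈ Finset.range (nScales L), (10 / 11 : ℝ) ^ j
            + 2 * nScales L := by
          rw [Finset.sum_add_distrib, Finset.sum_const, Finset.card_range, nsmul_eq_mul,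
            Finset.mul_sum]
          congr 1
          · refine Finset.sum_congr rfl fun j _ => ?_
            unfold scaleT
            rw [sqrt_mul (by positivity), sqrt_rho_pow, sqrt_div (Nat.cast_nonneg m),
              div_mul_eq_div_div]
            rw [show (10 / 11 : ℝ) ^ j = 1 / (11 / 10 : ℝ) ^ j by
              rw [one_div, ← inv_pow]; norm_num]
            ring
          · ring
      _ ≤ sqrt ((m : ℝ) / (ℓ + 1)) * 11 + 2 * nScales L := by
          gcongr; exact geom_sum_ten_elevenths_le _
      _ = 11 * sqrt ((m : ℝ) / (ℓ + 1)) + 2 * nScales L := by ring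
  linarith

end GroverSchedule


/-! ## Lee–Raghavendra–Steurer 2015, Theorem 1.8 (upper bound): `rk_psd(M_n^f) ≤ Σ_{i ≤ deg_sos(f)/2} C(n,i)` -/

section PatternMatrixUpperBound

variable {n m : ℕ}

/-- Restriction to a coordinate subset preserves degree: `deg(x ↦ g(x_S)) ≤ deg g` (rename the
variables of the representing polynomial). [cite: LeeRaghavendraSteurer2015, Thm 1.8 proof (p. 17: "define g_{S,j}(x) = g_j(x_S)")] -/
theorem HasDegreeLE.comp_cubeRestrict {k : ℕ} (S : {S : Finset (Fin n) // S.card = m})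
    {g : (Fin m → Bool) → ℝ} (hg : HasDegreeLE k g) :
    HasDegreeLE k (fun x : Fin n → Bool => g (cubeRestrict S x)) := by
  obtain ⟨P, hP, hPg⟩ := hg
  refine ⟨MvPolynomial.rename (S.1.orderEmbOfFin S.2) P,
    (MvPolynomial.totalDegree_rename_le _ _).trans hP, fun x => ?_⟩
  rw [MvPolynomial.eval_rename]
  exact hPg (cubeRestrict S x)

/-- Restriction to a coordinate subset preserves sos certificates: `f(x_S) = Σ_j g_j(x_S)²`.
[cite: LeeRaghavendraSteurer2015, Thm 1.8 proof (p. 17)] -/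
theorem HasSosCertificate.comp_cubeRestrict {d : ℕ} (S : {S : Finset (Fin n) // S.card = m})
    {f : (Fin m → Bool) → ℝ} (hf : HasSosCertificate d f) :
    HasSosCertificate d (fun x : Fin n → Bool => f (cubeRestrict S x)) := by
  obtain ⟨k, g, hg, hfx⟩ := hf
  exact ⟨k, fun i x => g i (cubeRestrict S x), fun i => (hg i).comp_cubeRestrict S, fun x => hfx _⟩

/-- **Lee–Raghavendra–Steurer 2015, Theorem 1.8 (upper bound)**, verbatim (p. 7): "For every `m ≥ 1`
and `f : {0,1}^m → ℝ_{≥0}` … if `d + 2 = deg_sos(f)`, then `1 + n^{1+d/2} ≥ rk_psd(M_n^f)`"; proof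
(p. 17): "Suppose `f = Σ_{j=1}^t g_j²` … `deg(g_j) ≤ 1 + d/2` … `(Q_x)_{A,B} = x^A x^B` and
`(P_S)_{A,B} = Σ_j ĝ_{S,j}(A) ĝ_{S,j}(B)` … yields an explicit psd factorization of `M_n^f` … of
dimension `r = Σ_{i ≤ 1+d/2} C(n,i) ≤ 1 + n^{1+d/2}`."  Typed in the tree's currency: an sos
certificate of `f` with squares of degree `≤ D` gives `rk_psd(M_n^f) ≤ Σ_{i ≤ D} C(n,i)` (here via the
Walsh basis instead of the monomials `x^A`, the same space). [cite: LeeRaghavendraSteurer2015, Thm 1.8 (p. 7), proof p. 17] -/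
theorem hasPsdFactorization_patternMatrix_of_hasSosCertificate {D : ℕ} {f : (Fin m → Bool) → ℝ}
    (hf : HasSosCertificate (2 * D) f) :
    HasPsdFactorization (patternMatrix n f) (∑ i ∈ Finset.range (D + 1), n.choose i) := by
  have h := hasPsdFactorization_of_hasSosCertificate (N := n)
    (fun (S : {S : Finset (Fin n) // S.card = m}) (x : Fin n → Bool) => f (cubeRestrict S x))
    fun S => hf.comp_cubeRestrict S
  exact h.transpose

/-- **Lee–Raghavendra–Steurer 2015, Theorem 1.8 (upper bound), printed size `1 + n^{1+d/2}`:**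
`rk_psd(M_n^f) ≤ 1 + n^D` when `f` has an sos certificate with squares of degree `≤ D`.
[cite: LeeRaghavendraSteurer2015, Thm 1.8 (p. 7: "1 + n^{1+d/2} ≥ rk_psd(M_n^f)")] -/
theorem hasPsdFactorization_patternMatrix_one_add_pow {D : ℕ} {f : (Fin m → Bool) → ℝ}
    (hf : HasSosCertificate (2 * D) f) : HasPsdFactorization (patternMatrix n f) (1 + n ^ D) :=
  (hasPsdFactorization_patternMatrix_of_hasSosCertificate hf).mono (sum_range_choose_le_one_add_pow n D)

end PatternMatrixUpperBound

/-! ## §7.2: the `log n` factor in Theorem 18 is necessary — `rk_psd((|x∧y|−1)²) = n + 1` exactly -/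

section LogFactorNecessary

variable {n : ℕ}

/-- Coordinatewise conjunction `x ∧ y`. [cite: KaniewskiLeeDewolf2015, §7.2 (p. 12: "M_f(x,y) = f(x ∧ y)")] -/
def bAnd (x y : Fin n → Bool) : Fin n → Bool := fun i => x i && y i

/-- **The matrix `M_f(x,y) = (|x ∧ y| − 1)²`** of the function `f(x) = (|x| − 1)²` ("`QE(f) = 1`").
[cite: KaniewskiLeeDewolf2015, §7.2 (p. 12)] -/
def klwMatrix (n : ℕ) : (Fin n → Bool) → (Fin n → Bool) → ℝ :=
  fun x y => (wt Finset.univ (bAnd x y) - 1) ^ 2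

/-- `|x ∧ y|` is the weight of `x` on the support of `y`. [folklore] -/
private theorem wt_univ_bAnd (x y : Fin n → Bool) :
    wt Finset.univ (bAnd x y) = wt (Finset.univ.filter fun i => y i) x := by
  unfold wt bAnd coordFn
  rw [Finset.sum_filter]
  refine Finset.sum_congr rfl fun i _ => ?_
  cases hx : x i <;> cases hy : y i <;> simp [hx, hy]

/-- **Upper bound (Theorem 18 with `T = 1`):** `M_f` has a psd factorisation of size
`Σ_{i≤1} C(n,i) = n + 1`, each column `x ↦ (|x ∧ y| − 1)²` being the square of a degree-`1` function.
[cite: KaniewskiLeeDewolf2015, §7.2 (p. 12: "QE(f) = 1") with Thm. 18] -/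
theorem hasPsdFactorization_klwMatrix (n : ℕ) : HasPsdFactorization (klwMatrix n) (n + 1) := by
  have h := hasPsdFactorization_of_hasSosCertificate (N := n) (D := 1)
    (fun (y : Fin n → Bool) (x : Fin n → Bool) => klwMatrix n x y) fun y => by
      have hf : (fun x => klwMatrix n x y) =
          fun x => (wt (Finset.univ.filter fun i => y i) x - 1) ^ 2 := by
        funext x; simp only [klwMatrix, wt_univ_bAnd]
      rw [hf]
      exact HasDegreeLE.hasSosCertificate_sq
        ((hasDegreeLE_wt _).sub (HasDegreeLE.const (m := n) 1 1))
  have hsum : ∑ i ∈ Finset.range (1 + 1), n.choose i = n + 1 := by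
    simp [Finset.sum_range_succ, add_comm]
  rw [hsum] at h
  exact h

/-- The indicator point `1_T ∈ {0,1}ⁿ`. [folklore] -/
private def indic (T : Finset (Fin n)) : Fin n → Bool := fun i => decide (i ∈ T)

/-- `|1_T ∧ 1_{T'}| = |T ∩ T'|`. [folklore] -/
private theorem wt_univ_bAnd_indic (T T' : Finset (Fin n)) :
    wt Finset.univ (bAnd (indic T) (indic T')) = ((T ∩ T').card : ℝ) := by
  classical
  rw [wt_eq_card_filter]
  congr 2
  ext i
  simp [bAnd, indic, Finset.mem_inter]

/-- The zeta matrix `Z_{S,T} = 1[S ⊆ T]` on the sets of size `≤ 2`. [folklore] -/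
private def zeta (n : ℕ) : Matrix (LowSets n 2) (LowSets n 2) ℝ :=
  fun S T => if S.1 ⊆ T.1 then 1 else 0

/-- The coefficients `c_0 = 1`, `c_1 = −1`, `c_2 = 2` of
`(k−1)² = 1·C(k,0) − 1·C(k,1) + 2·C(k,2)`. [cite: KaniewskiLeeDewolf2015, §7.2 (p. 12)] -/
private def coefCard (j : ℕ) : ℝ := if j = 0 then 1 else if j = 1 then -1 else 2

/-- The coefficients are nonzero. [folklore] -/
private theorem coefCard_ne_zero (j : ℕ) : coefCard j ≠ 0 := by
  unfold coefCard; split_ifs <;> norm_num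

/-- `det Z = 1`: `Z` is block-unitriangular for the cardinality grading. [folklore] -/
private theorem det_zeta (n : ℕ) : (zeta n).det = 1 := by
  classical
  have hbt : (zeta n).BlockTriangular (fun S : LowSets n 2 => S.1.card) := by
    intro S T hlt
    unfold zeta
    rw [if_neg]
    intro hsub
    exact absurd (Finset.card_le_card hsub) (not_le.2 hlt)
  rw [hbt.det]
  refine Finset.prod_eq_one fun a _ => ?_
  have hblock : (zeta n).toSquareBlock (fun S : LowSets n 2 => S.1.card) a = 1 := by
    ext ⟨S, hS⟩ ⟨T, hT⟩
    rw [Matrix.toSquareBlock_def, Matrix.of_apply, Matrix.one_apply]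
    unfold zeta
    by_cases h : S = T
    · subst h; simp
    · have hST : ¬ S.1 ⊆ T.1 := by
        intro hsub
        apply h
        have hc : T.1.card ≤ S.1.card := by
          change T.1.card = a at hT; change S.1.card = a at hS; omega
        exact Subtype.ext (Finset.eq_of_subset_of_card_le hsub hc)
      rw [if_neg hST, if_neg]
      exact fun h' => h (congrArg Subtype.val h')
  rw [hblock, Matrix.det_one]

/-- `Σ_{S ⊆ W} c_{|S|} = (|W| − 1)²` for `|W| ≤ 2`. [cite: KaniewskiLeeDewolf2015, §7.2 (p. 12)] -/
private theorem sum_powerset_coefCard {W : Finset (Fin n)} (hW : W.card ≤ 2) :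
    ∑ S ∈ W.powerset, coefCard S.card = ((W.card : ℝ) - 1) ^ 2 := by
  rw [Finset.sum_powerset_apply_card]
  interval_cases h : W.card <;> simp [Finset.sum_range_succ, coefCard]
  all_goals norm_num

/-- **The key identity `ZᵀDZ = (M_f(1_T, 1_{T'}))_{|T|,|T'|≤2}`.** [cite: KaniewskiLeeDewolf2015, §7.2 (p. 12)] -/
private theorem zeta_sandwich_apply (T T' : LowSets n 2) :
    ((zeta n)ᵀ * Matrix.diagonal (fun S : LowSets n 2 => coefCard S.1.card) * zeta n) T T' =
      (((T.1 ∩ T'.1).card : ℝ) - 1) ^ 2 := by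
  classical
  set W := T.1 ∩ T'.1 with hW
  have hWcard : W.card ≤ 2 := (Finset.card_le_card Finset.inter_subset_left).trans T.2
  let h : Finset (Fin n) → ℝ := fun S => if S ⊆ W then coefCard S.card else 0
  -- the triple product as a sum over `S : LowSets`
  have hsum : ((zeta n)ᵀ * Matrix.diagonal (fun S : LowSets n 2 => coefCard S.1.card) * zeta n) T T' =
      ∑ S : LowSets n 2, h S.1 := by
    rw [Matrix.mul_apply]
    refine Finset.sum_congr rfl fun S _ => ?_
    rw [Matrix.mul_diagonal, Matrix.transpose_apply]
    simp only [zeta, h, hW, Finset.subset_inter_iff]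
    by_cases h1 : S.1 ⊆ T.1 <;> by_cases h2 : S.1 ⊆ T'.1 <;> simp [h1, h2]
  -- the same sum over all finsets (terms with `|S| > 2` or `S ⊄ W` vanish), then over `W.powerset`
  have h1 : ∑ S : LowSets n 2, h S.1 =
      ∑ S ∈ (Finset.univ : Finset (Finset (Fin n))).filter (fun S => S.card ≤ 2), h S :=
    (Finset.sum_subtype _ (fun S => by simp) h).symm
  have h2 : ∑ S ∈ (Finset.univ : Finset (Finset (Fin n))).filter (fun S => S.card ≤ 2), h S =
      ∑ S, h S := by
    refine Finset.sum_subset (Finset.filter_subset _ _) fun S _ hS => ?_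
    have hS' : ¬ S.card ≤ 2 := by simpa using hS
    have : ¬ S ⊆ W := fun hsub => hS' ((Finset.card_le_card hsub).trans hWcard)
    simp [h, this]
  have h3 : ∑ S ∈ W.powerset, h S = ∑ S, h S := by
    refine Finset.sum_subset (Finset.subset_univ _) fun S _ hS => ?_
    rw [Finset.mem_powerset] at hS
    simp [h, hS]
  have h4 : ∑ S ∈ W.powerset, h S = ∑ S ∈ W.powerset, coefCard S.card := by
    refine Finset.sum_congr rfl fun S hS => ?_
    rw [Finset.mem_powerset] at hS
    simp [h, hS]
  rw [hsum, h1, h2, ← h3, h4, sum_powerset_coefCard hWcard]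

/-- **Rank lower bound:** every psd factorisation of `M_f` has size at least `n + 1`
(`rank M_f ≥ #{T : |T| ≤ 2} = C(n+1,2) + 1 > C(n+1,2) ≥ C(k+1,2)` for `k ≤ n`).
[cite: KaniewskiLeeDewolf2015, §7.2 (p. 12: "the rank of M_f … is n²/2 + 1"), with FawziEtAl2015 Prop. 2.5] -/
theorem le_of_hasPsdFactorization_klwMatrix {k : ℕ} (h : HasPsdFactorization (klwMatrix n) k) :
    n + 1 ≤ k := by
  classical
  -- the `{1_T}`-submatrix and its rank
  set R : Matrix (LowSets n 2) (LowSets n 2) ℝ :=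
    (zeta n)ᵀ * Matrix.diagonal (fun S : LowSets n 2 => coefCard S.1.card) * zeta n with hR
  have hRsub : R = Matrix.submatrix (klwMatrix n : Matrix (Fin n → Bool) (Fin n → Bool) ℝ)
      (fun T : LowSets n 2 => indic T.1) (fun T' : LowSets n 2 => indic T'.1) := by
    ext T T'
    rw [hR, zeta_sandwich_apply, Matrix.submatrix_apply]
    simp only [klwMatrix, wt_univ_bAnd_indic]
  have hdet : R.det ≠ 0 := by
    rw [hR, Matrix.det_mul, Matrix.det_mul, Matrix.det_transpose, det_zeta, Matrix.det_diagonal]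
    simp only [one_mul, mul_one]
    exact Finset.prod_ne_zero_iff.2 fun S _ => coefCard_ne_zero _
  have hrank : R.rank = Fintype.card (LowSets n 2) :=
    Matrix.rank_of_isUnit R ((Matrix.isUnit_iff_isUnit_det R).2 (isUnit_iff_ne_zero.2 hdet))
  have hle : Fintype.card (LowSets n 2) ≤ (k + 1).choose 2 := by
    rw [← hrank, hRsub]
    exact (Matrix.rank_submatrix_le _ _ _).trans h.rank_le_choose
  -- counting: `#{T : |T| ≤ 2} = 1 + n + C(n,2) = C(n+1,2) + 1`
  rw [card_lowSets] at hle
  have hcount : ∑ i ∈ Finset.range (2 + 1), n.choose i = (n + 1).choose 2 + 1 := by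
    simp [Finset.sum_range_succ, Nat.choose_succ_succ, Nat.choose_one_right]; ring
  rw [hcount] at hle
  by_contra hlt
  have hk : k + 1 ≤ n + 1 := by omega
  have := Nat.choose_le_choose 2 hk
  omega

/-- **The printed form:** `psdrk(M_f) ≥ n/√2` ("the `log n` factor in Theorem 18 is necessary": here
`QE(f) = 1` but the psd rank is `n + 1`, not `O(1)`). [cite: KaniewskiLeeDewolf2015, §7.2 (p. 12)] -/
theorem KaniewskiLeeDewolf2015_logFactor {k : ℕ} (h : HasPsdFactorization (klwMatrix n) k) :
    (n : ℝ) / Real.sqrt 2 ≤ k := by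
  have hk : ((n + 1 : ℕ) : ℝ) ≤ k := by exact_mod_cast le_of_hasPsdFactorization_klwMatrix h
  have hs : 1 ≤ Real.sqrt 2 := Real.one_le_sqrt.2 (by norm_num)
  have hn : (0 : ℝ) ≤ n := Nat.cast_nonneg n
  calc (n : ℝ) / Real.sqrt 2 ≤ n := div_le_self hn hs
    _ ≤ k := by push_cast at hk; linarith

end LogFactorNecessary

/-! ## FMPTW 2015, Corollary 22: `nnegrk((1 − aᵀb)²) ≥ (3/2)^n` versus `psdrk = n + 1` -/

section ExponentialSeparation

variable {n : ℕ}

open Literature.Barriers.PneNP (three_pow_le_card_mul_two_pow_of_cover_univ)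

/-- **Nonnegative rank of `M_ab = (1 − aᵀb)²` is at least `(3/2)^n`:** the support rectangles of a
size-`r` nonnegative factorisation avoid `|a ∩ b| = 1` (there `M = 0`) and cover the disjoint pairs
(there `M = 1`), so Kaibel–Weltge's count gives `3^n ≤ r·2^n` (printed: "any classical randomized
protocol needs `Ω(n)` bits", via the rectangle covering bound for the support of `M`).
[cite: FioriniEtAl2015, Thm. 21 proof and Cor. 22 (p. 15)] [cite: KaibelWeltge2014, Thm. 1] -/
theorem FioriniEtAl2015_cor22_nonneg {r : ℕ} (h : HasNonnegFactorization (klwMatrix n) r) :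
    3 ^ n ≤ r * 2 ^ n := by
  classical
  obtain ⟨U, V, hU, hV, hM⟩ := h
  have hentry : ∀ a b : Finset (Fin n),
      klwMatrix n (indic a) (indic b) = (((a ∩ b).card : ℝ) - 1) ^ 2 := fun a b => by
    simp only [klwMatrix, wt_univ_bAnd_indic]
  have key := three_pow_le_card_mul_two_pow_of_cover_univ (α := Fin n)
    (Finset.univ : Finset (Fin r))
    (fun l => {a : Finset (Fin n) | 0 < U (indic a) l})
    (fun l => {b : Finset (Fin n) | 0 < V l (indic b)})
    (fun l _ a ha b hb hone => by
      -- on the rectangle the entry is positive, but `|a ∩ b| = 1` forces it to vanish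
      have hpos : 0 < klwMatrix n (indic a) (indic b) := by
        rw [hM]
        refine lt_of_lt_of_le (mul_pos ha hb) ?_
        exact Finset.single_le_sum (f := fun l' => U (indic a) l' * V l' (indic b))
          (fun l' _ => mul_nonneg (hU _ _) (hV _ _)) (Finset.mem_univ l)
      rw [hentry, hone] at hpos
      norm_num at hpos)
    (fun a b hab => by
      -- on disjoint pairs the entry is `1`, so some rank-one term is positive there
      have hone : klwMatrix n (indic a) (indic b) = 1 := by
        rw [hentry, Finset.disjoint_iff_inter_eq_empty.1 hab]; norm_num
      have hex : ∃ l, 0 < U (indic a) l * V l (indic b) := by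
        by_contra hcon
        push Not at hcon
        have : klwMatrix n (indic a) (indic b) ≤ 0 := by
          rw [hM]; exact Finset.sum_nonpos fun l _ => hcon l
        linarith
      obtain ⟨l, hl⟩ := hex
      have hUl : 0 < U (indic a) l := by
        rcases (hU (indic a) l).lt_or_eq with h' | h'
        · exact h'
        · rw [← h', zero_mul] at hl; exact absurd hl (lt_irrefl 0)
      have hVl : 0 < V l (indic b) := by
        rcases (hV l (indic b)).lt_or_eq with h' | h'
        · exact h'
        · rw [← h', mul_zero] at hl; exact absurd hl (lt_irrefl 0)
      exact ⟨l, Finset.mem_univ l, hUl, hVl⟩)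
  simpa [Fintype.card_fin] using key

/-- **FMPTW 2015, Corollary 22 (exponential separation of nonnegative and psd rank), PROVED with
explicit constants:** the `2^n × 2^n` matrix `M_ab = (1 − aᵀb)²` has a psd factorisation of size
`n + 1` while every nonnegative factorisation has size `≥ (3/2)^n`.
[cite: FioriniEtAl2015, Cor. 22 (p. 15)] -/
theorem FioriniEtAl2015_cor22 (n : ℕ) :
    HasPsdFactorization (klwMatrix n) (n + 1) ∧
      ∀ r : ℕ, HasNonnegFactorization (klwMatrix n) r → (3 / 2 : ℝ) ^ n ≤ r := by
  refine ⟨hasPsdFactorization_klwMatrix n, fun r hr => ?_⟩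
  have h := FioriniEtAl2015_cor22_nonneg hr
  have h' : (3 : ℝ) ^ n ≤ r * 2 ^ n := by exact_mod_cast h
  rw [div_pow, div_le_iff₀ (by positivity)]
  exact h'

end ExponentialSeparation

end Literature.Combinatorics.Optimization
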